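import Summits.CriticalPhenomena.CardyFormulaZ2.Theses.CardyBoundaryCoulombGas
import Literature.Probability.Percolation.CornerPercolation
import Literature.Probability.RandomPlanarGeometry.CardyFunctionIncBeta

/-!
# Disproof of `BoundaryDefectGaussianR` — findings (cdisprove, standing adversary; cycle 2 v4, 2026-08-16)

Crux `stmt-CriticalPhenomena-14132` = rank-2 engine crux of route `CardyBoundaryCoulombGas`
(sub-problem `CardyFormulaZ2`), **INFORMAL** (signature `null` until `defn-CollarLegModel` lands; the
route file carries it only as a comment). Informal statement, condensed: for a bounded simply
connected `Ω` with axis-parallel polygonal boundary, `Ω_δ = Ω̄ ∩ δℤ²` with the closed BKW collar of the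
`Δ = -1/2` height model, and a RAINBOW LEG insertion datum `ins = ((x_i, L_i, s_i))_{i<k}` (`k ≥ 2`,
pairwise distinct non-corner boundary points in cyclic order, `L_i ≥ 1`, exactly one sink
`s_i = -1`, `Σ s_i L_i = 0`; lattice realisation = jump collar), one has `Z[ins]/Z = P_{1/2}[R(ins)]`
exactly and, with labels `e_i = L_i` (sources), `e = 1 - L` (sink), weights `h(e) = e(e-1)/6`:
  `∃ C = C(L, s; realisation) ∈ (0,∞)  ∀ Ω ∀ (x_i) ∀ conformal w : Ω → ℍ (w(x_i) finite):`
  `δ^{-Σ h(e_i)} · Z[ins]/Z ⟶ C · ∏_{i<j} |w(x_i) - w(x_j)|^{e_i e_j/3} · ∏_i |w′(x_i)|^{h(e_i)}`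
  `(δ → 0⁺, locally uniformly in admissible (x_i))`;
load-bearing members `(1,1,1;3)` (mark density, `Σh = 1`) and `(2;2)` (two-point connectivity,
`Σh = 2/3`).

## STATUS (cycle 2): not refuted; resists; no `¬S` file is possible (informal item, nothing to negate).
## NEW IN CYCLE 2 (gen-2 seat): §9 the constant of member (i) is CAPPED at Cardy's — `C ≤ cardyConst/3`
## for EVERY pointwise limit of the mark density (Lean, unconditional: disjointness + Fatou + `∂ₓF(η)`);
## §10 exact-TM tests of the 3-point member (1,1;2) (full covariant crossover shape to 1e-3, widths 5–9),
## of strip Cardy with its ₂F₁ correction (1e-3), and of the 3-leg Kac gap `γ₃/γ₁ → 3` (not naive 9/4);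
## §11 literature: Zhang's printed "¬Cardy on ℤ²" dissected (affine-invariance step), DGLZ 2024 sharp
## arm asymptotics (the crux's sharp normalisation is theorem-shaped on 𝕋), c = 0 logarithms do not enter
## rainbow (maximal-channel) members.

* In Lean the crux does not exist (`W.lean`: unknown identifier), so the refuter outcome
  `¬ BoundaryDefectGaussianR` is unavailable in principle this cycle. What IS typed here: the
  continuum right-hand side as a log-functional (`cgLog`, §1), the real Möbius group acting on
  uniformizing frames (`RealMoebius`), and the three percolation-only members on `ℤ × ℕ` (§3).
* ON PAPER the statement, once `Z[ins]/Z = P[R(ins)]` is substituted, is the standard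
  screening-free boundary Coulomb-gas block = maximal-fusion-channel prediction of `c = 0` boundary
  CFT for rainbow connectivities (DMS §9.2; Cardy 1992 for `(1,1,1;3)`; Simmons–Kleban–Ziff 2007 for
  `(1,1;2)`), internally consistent (§1–§2 are a machine-checked certificate of that) and consistent
  with every rigorous triangular-lattice fact (Smirnov–Werner half-plane exponents `j(j+1)/6`,
  Dubédat's `Beta(1/3,1/3)` law). Its truth for bond-`ℤ²` IS conformal covariance of boundary
  connectivities of critical bond percolation on `ℤ²` — open (no Smirnov theorem on `ℤ²`), not
  refutable by computation; the Monte Carlo of §7 is a consistency test — and the exact strip transfer matrices of §7 pass it at the 1e-3 level.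

## Index (all theorems sorry-free; namespace `…Cruxes.BoundaryDefectGaussianR.Disproof`)

§0 `hw` = `h(e) = e(e-1)/6`: table (`hw_two = 1/3`, `hw_neg_two = 1`, …), `hw_one_sub` (source/sink
   symmetry), `hw_fusion` (`h(a+b)-h(a)-h(b) = ab/3`), `hw_eq_hw_iff` (`h(e) = h(L) ↔ e ∈ {L, 1-L}`:
   the ONLY label freedom is source-vs-sink), `sum_hw`.
§1 `cgLog κ e u d = Σ_{i<j} κ e_i e_j log|u_i-u_j| + Σ_i h(e_i) log d_i` (claimed limit
   `= C·exp(cgLog (1/3) e (w∘x) |w′∘x|)`); `RealMoebius` (`SL(2,ℝ)` frames);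
   **`cgLog_moebius`** (anomaly formula: frame change shifts `cgLog` by
   `-Σ_i (κ e_i (S-e_i) + 2h(e_i)) log|c u_i + d|`, `S = Σe`);
   **`cgLog_moebius_invariant`** (`κ = 1/3 ∧ Σ e_i = 1 ⇒` frame independent: the crux's conclusion
   "for every uniformizing `w`" is self-consistent — the repair of F1 of stmt-6947, now in Lean);
   `cgLog_dilation`, `cgLog_dilation_third` (shift `h(Σe)·log λ`).
§2 Uniqueness of limits ⇒ which TYPINGS are contradictory outright (no percolation input):
   `frames_template`; **`not_lawInAllDilatedFrames_of_hw_sum_ne_zero`** (any label vector with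
   `h(Σe) ≠ 0`, i.e. `Σe ∉ {0,1}`, makes a "for all frames" law FALSE for EVERY lattice quantity);
   `not_law6947_family1113` (the predecessor's `κ = 2/3` dies under dilations already);
   **`not_lawInAllMoebiusFrames_naiveSink`** (the naive-stiffness sink label `-L`, total label `0`,
   passes dilations but dies under `t ↦ -1/t`: `(1/3)log 6 ≠ log 4`) — so `e_sink = 1-L` (the route's
   "rim flux `m₀ = -1/2`") is FORCED by covariance + `h`, cf. `hw_eq_hw_iff`.
§3 Typed shadows on `ℤ × ℕ` (`w = id`, `δ = 1/n`): `HalfPlaneTwoPointLaw` (2;2),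
   `HalfPlaneArcPointLaw` (1,1;2), `HalfPlaneMarkDensityShape` (1,1,1;3) and
   `markDensityShape_of_law : HalfPlaneMarkDensityLaw (stmt-5661) → HalfPlaneMarkDensityShape`.
§4 Refuted strengthening: **`not_halfPlaneTwoPointLawUniform`** — "locally uniformly" cannot become
   "uniformly on `{x<y}`" (only `P ≤ 1` is used): near-diagonal / near-mark control in the route's
   integration step must come from a-priori (RSW) bounds, never from the local law.
§4b `arcPointSeq_union_le`, `limitShape_subadditive` (a lattice union bound every (1,1;2) limit must
   satisfy) and `claimedShape_passes_union_bound` (the claimed shape meets it: harmonic-measure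
   additivity `hm_additive` + subadditivity of `t^{1/3}`).
§9 (cycle 2, Lean) `HalfPlaneMarkDensityShapeWith C` (member (i) with a prescribed constant);
   `sum_real_markEvent_le_one`, **`biUnion_markEvent`**, `sum_real_markEvent_eq`, `riemannSum_markDensity_eq`
   (EXACT at every mesh: the mark events partition the crossing event — `Σ_x m_δ(x) = P[A ↔ [c,X]]`);
   `lintegral_shape_le_one` / `integral_shape_le_one` (Fatou: `C ∫_{c'}^{X} shape ≤ 1`);
   `hasDerivAt_cardy_etaFun` (`(cardyConst/3)·shape = ∂ₓ F(η(a,b,c,x))`, chain rule on the tree's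
   `hasDerivAt_cardyFunction_holds`); **`constant_le_of_markDensityShapeWith`** (`C ≤ cardyConst/3`,
   axioms propext/choice/quot.sound) and `not_markDensityShapeWith_of_gt`; `shapeWith_of_law`
   (stmt-5661 is the extremal instance `C = cardyConst/3`); `sharpTwoPoint_of_twoPointLaw` (the crux
   asserts SHARP arm asymptotics, cf. §11).
§9b (cycle 2, Lean) `markEvent_union_subset`, `markDensitySeq_arc_union_le`, `limitDensity_subadditive_in_arc`
   (exact sub-additivity of the mark density in the ARC; the claimed shape passes, numerically min ratio 1.0157).
§10 (cycle 2) Numerics: exact strip TMs for (1,1;2), strip Cardy, the 3-leg gap, and why member (i)'s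
   near-field exponents are out of reach of widths ≤ 10 · §11 (cycle 2) Literature attacks.
§5 Load-bearing hypotheses (analysis, with the evidence for each) · §6 Why it resists / what a
   refutation would have to be · §7 Numerics: EXACT strip transfer matrices for (2;2) — amplitude
   covariance, sinh/cosh shapes, parameter-free corner-proximity law all pass at 1e-3; boundary one-arm
   exponent → 1/3 across the strip; corner points change the exponents (H-noncorner) · §8 Targets & near-misses (none: no line picked).

Inputs used: the item text and route file (rev 9); refuter notes on stmt-6947 (F1–F6, C′) and on this
item (rattack 2026-08-15: BPZ level-2/3 consistency of 25 families, fusion-path uniqueness); the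
item's attached SPEC/EVIDENCE files are NOT readable from this hub (gate evidence store), so the event
dictionary for sources with `L ≥ 2` beyond `(2;2)` is reconstructed in §5, not re-verified.
-/

noncomputable section

open Filter Topology Set MeasureTheory
open scoped BigOperators ENNReal

namespace Summit.CriticalPhenomena.CardyFormulaZ2.Cruxes.BoundaryDefectGaussianR.Disproof

/-! ### §0 Numerology of the crux: boundary weights `h(e) = e(e-1)/6` -/

/-- The boundary weight of a label `e`: `h(e) = e(e-1)/6` (`= h_{1,L+1} = L(L-1)/6` at `κ = 6` for
`e ∈ {L, 1-L}`). [folklore] -/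
def hw (e : ℝ) : ℝ := e * (e - 1) / 6

@[simp] theorem hw_zero : hw 0 = 0 := by simp [hw]
@[simp] theorem hw_one : hw 1 = 0 := by simp [hw]
theorem hw_two : hw 2 = 1 / 3 := by norm_num [hw]
theorem hw_three : hw 3 = 1 := by norm_num [hw]
theorem hw_four : hw 4 = 2 := by norm_num [hw]
theorem hw_neg_one : hw (-1) = 1 / 3 := by norm_num [hw]
theorem hw_neg_two : hw (-2) = 1 := by norm_num [hw]
theorem hw_neg_three : hw (-3) = 2 := by norm_num [hw]

/-- Source/sink symmetry of the weights: `h(1-e) = h(e)`. [folklore] -/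
theorem hw_one_sub (e : ℝ) : hw (1 - e) = hw e := by unfold hw; ring

/-- The fusion rule quoted in the crux: `h(a+b) - h(a) - h(b) = ab/3` (pair coupling `2A = 1/3`). [folklore] -/
theorem hw_fusion (a b : ℝ) : hw (a + b) - hw a - hw b = a * b / 3 := by unfold hw; ring

/-- A label has the weight of `L` legs iff it is `L` (source) or `1 - L` (sink). [folklore] -/
theorem hw_eq_hw_iff (e L : ℝ) : hw e = hw L ↔ e = L ∨ e = 1 - L := by
  constructor
  · intro h
    have h2 : (e - L) * (e - (1 - L)) = 0 := by unfold hw at h; linear_combination (6 : ℝ) * h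
    rcases mul_eq_zero.1 h2 with h3 | h3
    · left; linarith
    · right; linarith
  · rintro (rfl | rfl)
    · rfl
    · exact hw_one_sub L

/-- `Σ h(e_i) = (Σ e_i² - Σ e_i)/6`. [folklore] -/
theorem sum_hw {k : ℕ} (e : Fin k → ℝ) : ∑ i, hw (e i) = ((∑ i, e i ^ 2) - ∑ i, e i) / 6 := by
  unfold hw
  rw [← Finset.sum_sub_distrib, Finset.sum_div]
  refine Finset.sum_congr rfl fun i _ => ?_
  ring

/-! ### §1 The claimed continuum limit as a log-functional, and its frame (in)dependence -/

variable {k : ℕ}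

/-- Pair part of the Coulomb-gas log-functional with pair coupling `κ`:
`Σ_{i<j} κ e_i e_j log |u_i - u_j|` (`u_i = w(x_i)`). The crux has `κ = 1/3`; the refuted
predecessor stmt-6947 had `κ = 4A = 2/3`. [folklore] -/
def pairLog (κ : ℝ) (e u : Fin k → ℝ) : ℝ :=
  ∑ i, ∑ j, if i < j then κ * (e i * e j) * Real.log |u i - u j| else 0

/-- Weight part `Σ_i h(e_i) log d_i` (`d_i = |w′(x_i)|`). [folklore] -/
def weightLog (e d : Fin k → ℝ) : ℝ := ∑ i, hw (e i) * Real.log (d i)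

/-- The Coulomb-gas log-functional: the crux claims
`δ^{-Σ h(e_i)} Z[ins]/Z → C · exp (cgLog (1/3) e (w ∘ x) |w′ ∘ x|)`. [folklore] -/
def cgLog (κ : ℝ) (e u d : Fin k → ℝ) : ℝ := pairLog κ e u + weightLog e d

/-- Symmetrisation of a sum over pairs: for symmetric `x`,
`Σ_{i<j} x_{ij} (L_i + L_j) = Σ_i L_i (Σ_j x_{ij} - x_{ii})`. [folklore] -/
theorem sum_pairs_symm (x : Fin k → Fin k → ℝ) (hx : ∀ i j, x i j = x j i) (L : Fin k → ℝ) :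
    (∑ i, ∑ j, if i < j then x i j * (L i + L j) else 0) = ∑ i, L i * (∑ j, x i j - x i i) := by
  have h1 : (∑ i, ∑ j, if i < j then x i j * (L i + L j) else 0)
      = (∑ i, ∑ j, if i < j then x i j * L i else 0) + ∑ i, ∑ j, if i < j then x i j * L j else 0 := by
    rw [← Finset.sum_add_distrib]
    refine Finset.sum_congr rfl fun i _ => ?_
    rw [← Finset.sum_add_distrib]
    refine Finset.sum_congr rfl fun j _ => ?_
    split_ifs <;> ring
  have h2 : (∑ i, ∑ j, if i < j then x i j * L j else 0)
      = ∑ i, ∑ j, if j < i then x i j * L i else 0 := by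
    rw [Finset.sum_comm]
    refine Finset.sum_congr rfl fun i _ => Finset.sum_congr rfl fun j _ => ?_
    rw [hx j i]
  rw [h1, h2, ← Finset.sum_add_distrib]
  refine Finset.sum_congr rfl fun i _ => ?_
  rw [← Finset.sum_add_distrib]
  have h3 : ∀ j, ((if i < j then x i j * L i else 0) + if j < i then x i j * L i else 0)
      = x i j * L i - if j = i then x i j * L i else 0 := by
    intro j
    rcases lt_trichotomy i j with h | h | h
    · rw [if_pos h, if_neg (not_lt.2 h.le), if_neg h.ne']; ring
    · subst h; simp
    · rw [if_neg (not_lt.2 h.le), if_pos h, if_neg h.ne]; ring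
  rw [Finset.sum_congr rfl fun j _ => h3 j, Finset.sum_sub_distrib, Finset.sum_ite_eq' Finset.univ i,
    if_pos (Finset.mem_univ i), ← Finset.sum_mul]
  ring

/-- `Σ_{i<j} e_i e_j = ((Σ e)^2 - Σ e^2)/2`. [folklore] -/
theorem sum_pairs_prod (e : Fin k → ℝ) :
    (∑ i, ∑ j, if i < j then e i * e j else 0) = ((∑ i, e i) ^ 2 - ∑ i, e i ^ 2) / 2 := by
  have h := sum_pairs_symm (fun i j => e i * e j) (fun i j => mul_comm _ _) (fun _ => (1 / 2 : ℝ))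
  have h' : (∑ i, ∑ j, if i < j then e i * e j else 0)
      = ∑ i : Fin k, ∑ j : Fin k, if i < j then e i * e j * (1 / 2 + 1 / 2) else 0 := by
    refine Finset.sum_congr rfl fun i _ => Finset.sum_congr rfl fun j _ => ?_
    split_ifs <;> ring
  rw [h', h, sq, Finset.sum_mul_sum, ← Finset.sum_sub_distrib, Finset.sum_div]
  refine Finset.sum_congr rfl fun i _ => ?_
  ring

/-- A real Möbius map `t ↦ (a t + b)/(c t + d)` with `a d - b c = 1` (an element of `SL(2,ℝ)`: the
orientation-preserving conformal automorphisms of `ℍ`, i.e. the changes of uniformizing map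
`w ↦ g ∘ w` in the crux). [folklore] -/
structure RealMoebius where
  /-- coefficient `a` -/
  a : ℝ
  /-- coefficient `b` -/
  b : ℝ
  /-- coefficient `c` -/
  c : ℝ
  /-- coefficient `d` -/
  d : ℝ
  /-- unimodularity -/
  det : a * d - b * c = 1

namespace RealMoebius

/-- The map on the (finite part of the) real line. [folklore] -/
def toFun (g : RealMoebius) (t : ℝ) : ℝ := (g.a * t + g.b) / (g.c * t + g.d)

/-- Its derivative where finite: `g′(t) = (c t + d)⁻²` (positive). [folklore] -/
def deriv (g : RealMoebius) (t : ℝ) : ℝ := 1 / (g.c * t + g.d) ^ 2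

/-- The identity frame change. [folklore] -/
def id : RealMoebius := ⟨1, 0, 0, 1, by norm_num⟩

/-- The inversion `t ↦ -1/t`. [folklore] -/
def inv : RealMoebius := ⟨0, -1, 1, 0, by norm_num⟩

@[simp] theorem id_toFun (t : ℝ) : id.toFun t = t := by simp [id, toFun]
@[simp] theorem id_deriv (t : ℝ) : id.deriv t = 1 := by simp [id, deriv]
@[simp] theorem inv_c : inv.c = 1 := rfl
@[simp] theorem inv_d : inv.d = 0 := rfl
theorem inv_toFun (t : ℝ) : inv.toFun t = -1 / t := by simp [inv, toFun]
theorem inv_deriv (t : ℝ) : inv.deriv t = 1 / t ^ 2 := by simp [inv, deriv]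

/-- The basic Möbius identity `g s - g t = (s - t) / ((c s + d)(c t + d))`. [folklore] -/
theorem sub_eq (g : RealMoebius) {s t : ℝ} (hs : g.c * s + g.d ≠ 0) (ht : g.c * t + g.d ≠ 0) :
    g.toFun s - g.toFun t = (s - t) / ((g.c * s + g.d) * (g.c * t + g.d)) := by
  unfold toFun
  rw [div_sub_div _ _ hs ht, eq_div_iff (mul_ne_zero hs ht), div_mul_cancel₀ _ (mul_ne_zero hs ht)]
  linear_combination (s - t) * g.det

/-- `log |g s - g t| = log |s - t| - log |c s + d| - log |c t + d|` for `s ≠ t`. [folklore] -/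
theorem log_abs_sub (g : RealMoebius) {s t : ℝ} (hs : g.c * s + g.d ≠ 0) (ht : g.c * t + g.d ≠ 0)
    (hst : s ≠ t) :
    Real.log |g.toFun s - g.toFun t|
      = Real.log |s - t| - Real.log |g.c * s + g.d| - Real.log |g.c * t + g.d| := by
  rw [g.sub_eq hs ht, abs_div, abs_mul,
    Real.log_div (abs_ne_zero.2 (sub_ne_zero.2 hst)) (mul_ne_zero (abs_ne_zero.2 hs) (abs_ne_zero.2 ht)),
    Real.log_mul (abs_ne_zero.2 hs) (abs_ne_zero.2 ht)]
  ring

theorem deriv_ne_zero (g : RealMoebius) {t : ℝ} (ht : g.c * t + g.d ≠ 0) : g.deriv t ≠ 0 := by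
  unfold deriv; positivity

theorem deriv_pos (g : RealMoebius) {t : ℝ} (ht : g.c * t + g.d ≠ 0) : 0 < g.deriv t := by
  unfold deriv; positivity

/-- `log g′(t) = -2 log |c t + d|`. [folklore] -/
theorem log_deriv (g : RealMoebius) (t : ℝ) :
    Real.log (g.deriv t) = -2 * Real.log |g.c * t + g.d| := by
  unfold deriv
  rw [one_div, Real.log_inv, Real.log_pow, Real.log_abs]
  push_cast
  ring

end RealMoebius

/-- **Anomaly formula.** Under the frame change `w ↦ g ∘ w` (so `u_i ↦ g(u_i)`, `d_i ↦ g′(u_i) d_i`)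
the log-functional with pair coupling `κ` shifts by
`- Σ_i (κ e_i (S - e_i) + 2 h(e_i)) · log |c u_i + d|`, `S = Σ e_i`. [folklore] -/
theorem cgLog_moebius (κ : ℝ) (e u d : Fin k → ℝ) (g : RealMoebius)
    (hu : Function.Injective u) (hfin : ∀ i, g.c * u i + g.d ≠ 0) (hd : ∀ i, d i ≠ 0) :
    cgLog κ e (fun i => g.toFun (u i)) (fun i => g.deriv (u i) * d i)
      = cgLog κ e u d
        - ∑ i, (κ * e i * ((∑ j, e j) - e i) + 2 * hw (e i)) * Real.log |g.c * u i + g.d| := by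
  set ℓ : Fin k → ℝ := fun i => Real.log |g.c * u i + g.d| with hℓ
  have hpair : pairLog κ e (fun i => g.toFun (u i))
      = pairLog κ e u - ∑ i, ∑ j, if i < j then κ * (e i * e j) * (ℓ i + ℓ j) else 0 := by
    unfold pairLog
    rw [← Finset.sum_sub_distrib]
    refine Finset.sum_congr rfl fun i _ => ?_
    rw [← Finset.sum_sub_distrib]
    refine Finset.sum_congr rfl fun j _ => ?_
    split_ifs with hij
    · rw [g.log_abs_sub (hfin i) (hfin j) (fun h => hij.ne (hu h))]
      ring
    · simp
  have hsymm := sum_pairs_symm (fun i j => κ * (e i * e j)) (by intro i j; ring) ℓ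
  have hweight : weightLog e (fun i => g.deriv (u i) * d i)
      = weightLog e d - ∑ i, 2 * hw (e i) * ℓ i := by
    unfold weightLog
    rw [← Finset.sum_sub_distrib]
    refine Finset.sum_congr rfl fun i _ => ?_
    rw [Real.log_mul (g.deriv_ne_zero (hfin i)) (hd i), g.log_deriv (u i)]
    ring
  have hinner : ∀ i, (∑ j, κ * (e i * e j)) = κ * e i * ∑ j, e j := by
    intro i
    rw [Finset.mul_sum]
    refine Finset.sum_congr rfl fun j _ => ?_
    ring
  have key : (∑ i, ℓ i * ((∑ j, κ * (e i * e j)) - κ * (e i * e i))) + ∑ i, 2 * hw (e i) * ℓ i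
      = ∑ i, (κ * e i * ((∑ j, e j) - e i) + 2 * hw (e i)) * Real.log |g.c * u i + g.d| := by
    rw [← Finset.sum_add_distrib]
    refine Finset.sum_congr rfl fun i _ => ?_
    rw [hinner i]
    ring
  unfold cgLog
  rw [hpair, hweight, hsymm]
  linear_combination (-1 : ℝ) * key

/-- **Frame independence of the crux's bookkeeping** (`κ = 1/3`, `Σ e_i = 1`): the claimed limit does
not depend on the `PSL(2,ℝ)` choice of the uniformizing map. This is what makes the conclusion of
`BoundaryDefectGaussianR` ("for every conformal `w : Ω → ℍ`") internally consistent, and it is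
exactly the repair of witness F1 against stmt-6947. [folklore] -/
theorem cgLog_moebius_invariant (e u d : Fin k → ℝ) (g : RealMoebius) (hu : Function.Injective u)
    (hfin : ∀ i, g.c * u i + g.d ≠ 0) (hd : ∀ i, d i ≠ 0) (hsum : ∑ i, e i = 1) :
    cgLog (1 / 3) e (fun i => g.toFun (u i)) (fun i => g.deriv (u i) * d i) = cgLog (1 / 3) e u d := by
  rw [cgLog_moebius _ _ _ _ _ hu hfin hd, hsum]
  have h0 : ∀ i, (1 / 3 * e i * (1 - e i) + 2 * hw (e i)) = 0 := by
    intro i; unfold hw; ring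
  have hz : ∑ i, (1 / 3 * e i * (1 - e i) + 2 * hw (e i)) * Real.log |g.c * u i + g.d| = 0 :=
    Finset.sum_eq_zero fun i _ => by rw [h0 i, zero_mul]
  rw [hz, sub_zero]

/-- **Dilation law** for general pair coupling: under `w ↦ λ w` the log-functional shifts by
`(κ ((Σe)² - Σe²)/2 + Σ h(e_i)) log λ`. [folklore] -/
theorem cgLog_dilation (κ : ℝ) (e u d : Fin k → ℝ) {lam : ℝ} (hlam : 0 < lam)
    (hu : Function.Injective u) (hd : ∀ i, d i ≠ 0) :
    cgLog κ e (fun i => lam * u i) (fun i => lam * d i)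
      = cgLog κ e u d
        + (κ * (((∑ i, e i) ^ 2 - ∑ i, e i ^ 2) / 2) + ∑ i, hw (e i)) * Real.log lam := by
  have hpair : pairLog κ e (fun i => lam * u i)
      = pairLog κ e u + (κ * Real.log lam) * ∑ i, ∑ j, if i < j then e i * e j else 0 := by
    unfold pairLog
    rw [Finset.mul_sum, ← Finset.sum_add_distrib]
    refine Finset.sum_congr rfl fun i _ => ?_
    rw [Finset.mul_sum, ← Finset.sum_add_distrib]
    refine Finset.sum_congr rfl fun j _ => ?_
    split_ifs with hij
    · rw [← mul_sub, abs_mul, abs_of_pos hlam,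
        Real.log_mul hlam.ne' (abs_ne_zero.2 (sub_ne_zero.2 fun h => hij.ne (hu h)))]
      ring
    · simp
  have hweight : weightLog e (fun i => lam * d i) = weightLog e d + (∑ i, hw (e i)) * Real.log lam := by
    unfold weightLog
    rw [Finset.sum_mul, ← Finset.sum_add_distrib]
    refine Finset.sum_congr rfl fun i _ => ?_
    rw [Real.log_mul hlam.ne' (hd i)]
    ring
  unfold cgLog
  rw [hpair, hweight, sum_pairs_prod]
  ring

/-- Dilation law at the crux's coupling `κ = 1/3`: the shift is `h(Σ e_i) · log λ`; it vanishes iff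
`Σ e_i ∈ {0, 1}`. [folklore] -/
theorem cgLog_dilation_third (e u d : Fin k → ℝ) {lam : ℝ} (hlam : 0 < lam)
    (hu : Function.Injective u) (hd : ∀ i, d i ≠ 0) :
    cgLog (1 / 3) e (fun i => lam * u i) (fun i => lam * d i)
      = cgLog (1 / 3) e u d + hw (∑ i, e i) * Real.log lam := by
  rw [cgLog_dilation _ _ _ _ hlam hu hd, sum_hw]
  unfold hw
  ring

/-! ### §2 Uniqueness of limits: which typings of the crux are self-contradictory -/

/-- Template: one lattice quantity cannot converge to `C·F₁` and `C·F₂` with `F₁ ≠ F₂`, `C ≠ 0`.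
Every "for every uniformizing `w`" clause therefore FORCES the right-hand side to be a frame
invariant; where it is not, the typed statement is refutable by pure logic (no percolation input).
[folklore] -/
theorem frames_template {ι : Type*} {l : Filter ι} [l.NeBot] {a : ι → ℝ} {C F₁ F₂ : ℝ}
    (hC : C ≠ 0) (h₁ : Tendsto a l (𝓝 (C * F₁))) (h₂ : Tendsto a l (𝓝 (C * F₂))) : F₁ = F₂ :=
  mul_left_cancel₀ hC (tendsto_nhds_unique h₁ h₂)

/-- If `h(Σ e_i) ≠ 0` (total label not in `{0,1}`), NO lattice quantity `a` can satisfy the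
crux-shaped law in all dilated frames: the frames `w` and `2w` predict different limits.
(Load-bearing analysis of the neutrality hypothesis `Σ s_i L_i = 0`, i.e. `Σ e_i = 1`.) [folklore] -/
theorem not_lawInAllDilatedFrames_of_hw_sum_ne_zero {ι : Type*} {l : Filter ι} [l.NeBot]
    (a : ι → ℝ) {C : ℝ} (hC : 0 < C) (e u d : Fin k → ℝ) (hu : Function.Injective u)
    (hd : ∀ i, d i ≠ 0) (hS : hw (∑ i, e i) ≠ 0)
    (h : ∀ lam : ℝ, 0 < lam →
      Tendsto a l (𝓝 (C * Real.exp (cgLog (1 / 3) e (fun i => lam * u i) (fun i => lam * d i))))) :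
    False := by
  have h1 := h 1 one_pos
  have h2 := h 2 two_pos
  simp only [one_mul] at h1
  have h12 := frames_template hC.ne' h1 h2
  rw [cgLog_dilation_third _ _ _ two_pos hu hd, Real.exp_eq_exp] at h12
  have : hw (∑ i, e i) * Real.log 2 = 0 := by linarith
  rcases mul_eq_zero.1 this with h0 | h0
  · exact hS h0
  · exact (Real.log_pos one_lt_two).ne' h0

/-- The predecessor's coupling `κ = 4A = 2/3` (stmt-6947, witness F1) is already inconsistent under
DILATIONS for the load-bearing family `(1,1,1;3)`, labels `(1,1,1,-2)`: the shift coefficient is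
`(2/3)·(1-7)/2 + 1 = -1 ≠ 0`. [folklore] -/
theorem shift_6947_family1113 :
    (2 / 3 : ℝ) * (((∑ i, (![1, 1, 1, -2] : Fin 4 → ℝ) i) ^ 2
        - ∑ i, (![1, 1, 1, -2] : Fin 4 → ℝ) i ^ 2) / 2)
      + ∑ i, hw ((![1, 1, 1, -2] : Fin 4 → ℝ) i) = -1 := by
  simp [Fin.sum_univ_four, hw]
  norm_num

/-- Hence no lattice quantity obeys a 6947-shaped law (`κ = 2/3`) in all dilated frames. [folklore] -/
theorem not_law6947_family1113 {ι : Type*} {l : Filter ι} [l.NeBot] (a : ι → ℝ) {C : ℝ}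
    (hC : 0 < C) (u d : Fin 4 → ℝ) (hu : Function.Injective u) (hd : ∀ i, d i ≠ 0)
    (h : ∀ lam : ℝ, 0 < lam →
      Tendsto a l (𝓝 (C * Real.exp
        (cgLog (2 / 3) ![1, 1, 1, -2] (fun i => lam * u i) (fun i => lam * d i))))) : False := by
  have h1 := h 1 one_pos
  have h2 := h 2 two_pos
  simp only [one_mul] at h1
  have h12 := frames_template hC.ne' h1 h2
  rw [cgLog_dilation _ _ _ _ two_pos hu hd, shift_6947_family1113, Real.exp_eq_exp] at h12
  have : Real.log 2 = 0 := by linarith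
  exact (Real.log_pos one_lt_two).ne' this

/-- The "naive stiffness" sink rule `e_sink = -L` (labels `(1,1,1,-3)` for `(1,1,1;3)`, total label
`0`) passes dilations (`h(0) = 0`) but NOT the inversion `t ↦ -1/t`: at the configuration
`u = (1,2,3,4)` the anomaly is `(1/3) log 6 - log 4 ≠ 0`. So the sink rule `e = 1 - L` of the crux is
the unique frame-consistent labelling with source labels `L_i` (cf. `hw_eq_hw_iff`). [folklore] -/
theorem naiveSink_anomaly_ne_zero :
    ∑ i, ((1 / 3 : ℝ) * (![1, 1, 1, -3] : Fin 4 → ℝ) i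
        * ((∑ j, (![1, 1, 1, -3] : Fin 4 → ℝ) j) - (![1, 1, 1, -3] : Fin 4 → ℝ) i)
        + 2 * hw ((![1, 1, 1, -3] : Fin 4 → ℝ) i))
      * Real.log |RealMoebius.inv.c * (![1, 2, 3, 4] : Fin 4 → ℝ) i + RealMoebius.inv.d| ≠ 0 := by
  simp only [Fin.sum_univ_four, RealMoebius.inv_c, RealMoebius.inv_d]
  simp only [Matrix.cons_val_zero, Matrix.cons_val_one, Matrix.head_cons, Matrix.cons_val_two,
    Matrix.tail_cons, Matrix.cons_val_three, hw]
  norm_num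
  -- goal should be a linear relation between log 2, log 3, log 4
  have h6 : Real.log 6 = Real.log 2 + Real.log 3 := by
    rw [show (6 : ℝ) = 2 * 3 by norm_num, Real.log_mul (by norm_num) (by norm_num)]
  have h4 : Real.log 4 = 2 * Real.log 2 := by
    rw [show (4 : ℝ) = 2 ^ 2 by norm_num, Real.log_pow]; push_cast; ring
  have hlt : Real.log 6 < Real.log 64 := Real.log_lt_log (by norm_num) (by norm_num)
  have h64 : Real.log 64 = 6 * Real.log 2 := by
    rw [show (64 : ℝ) = 2 ^ 6 by norm_num, Real.log_pow]; push_cast; ring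
  intro h
  nlinarith [h6, h4, hlt, h64, h]


/-- The four reference boundary points `(1,2,3,4)` are pairwise distinct. [folklore] -/
theorem injective_u1234 : Function.Injective (![1, 2, 3, 4] : Fin 4 → ℝ) := by
  intro i j h
  fin_cases i <;> fin_cases j <;> norm_num at h <;> rfl

/-- **The naive sink rule is not frame-consistent.** No lattice quantity can obey, in all Möbius
frames of the configuration `(1,2,3,4)`, a crux-shaped law with labels `(1,1,1,-3)` (sink label
`-L` instead of `1-L`): the identity frame and the inversion `t ↦ -1/t` predict different limits.
This is the Lean form of the observation (stmt-6952 refuter g2; this crux's rev-6 "rim flux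
`m₀ = -1/2`") that the linear background-charge term is FORCED by covariance, not a free choice.
[folklore] -/
theorem not_lawInAllMoebiusFrames_naiveSink {ι : Type*} {l : Filter ι} [l.NeBot] (a : ι → ℝ)
    {C : ℝ} (hC : 0 < C) (d : Fin 4 → ℝ) (hd : ∀ i, d i ≠ 0)
    (h : ∀ g : RealMoebius, (∀ i, g.c * (![1, 2, 3, 4] : Fin 4 → ℝ) i + g.d ≠ 0) →
      Tendsto a l (𝓝 (C * Real.exp (cgLog (1 / 3) ![1, 1, 1, -3]
        (fun i => g.toFun ((![1, 2, 3, 4] : Fin 4 → ℝ) i))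
        (fun i => g.deriv ((![1, 2, 3, 4] : Fin 4 → ℝ) i) * d i))))) :
    False := by
  have hfin : ∀ i, RealMoebius.inv.c * (![1, 2, 3, 4] : Fin 4 → ℝ) i + RealMoebius.inv.d ≠ 0 := by
    intro i; fin_cases i <;> simp
  have hid := h RealMoebius.id (by intro i; simp [RealMoebius.id])
  have hinv := h RealMoebius.inv hfin
  simp only [RealMoebius.id_toFun, RealMoebius.id_deriv, one_mul] at hid
  have h12 := frames_template hC.ne' hid hinv
  rw [Real.exp_eq_exp, cgLog_moebius (1 / 3) _ _ _ RealMoebius.inv injective_u1234 hfin hd] at h12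
  exact naiveSink_anomaly_ne_zero (by linarith)

/-! ### §3 Typed shadows of the load-bearing members (percolation only: `Ω = ℍ`, `w = id`, `δ = 1/n`)

The crux is INFORMAL (no Lean constant `BoundaryDefectGaussianR` exists before
`defn-CollarLegModel` lands), so no `¬ BoundaryDefectGaussianR` file is possible. After the exact
dictionary `Z[ins]/Z = P[rainbow event]` (SPEC §D4) its two load-bearing members on `ℤ × ℕ` are
plain bond-percolation statements; they are typed here so that attacks have a target. -/

open Literature.Probability.Percolation Literature.Probability.LatticeModels
open Literature.Probability.RandomPlanarGeometry (cardyConst cardyConst_pos)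

/-- Bond percolation on `ℤ²` at `p = 1/2`. [folklore] -/
abbrev μhalf : Measure (BondConfig (Site 2)) := bondPercolation (zdGraph 2) half

/-- The closed upper half-lattice `ℤ × ℕ`. [folklore] -/
def halfLattice : Set (Site 2) := {v | 0 ≤ v 1}

/-- The boundary lattice point `(⌊t n⌋, 0)`. [folklore] -/
def bpt (t : ℝ) (n : ℕ) : Site 2 := ![⌊t * n⌋, 0]

/-- The boundary lattice arc `[⌊a n⌋, ⌊b n⌋] × {0}`. [folklore] -/
def barc (a b : ℝ) (n : ℕ) : Set (Site 2) := {v | v 1 = 0 ∧ ⌊a * n⌋ ≤ v 0 ∧ v 0 ≤ ⌊b * n⌋}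

/-- Member `(2;2)` of the crux on `ℤ × ℕ`, `w = id`: `n^{2/3} · P_{1/2}[(⌊xn⌋,0) ↔ (⌊yn⌋,0) in ℤ × ℕ]`.
[folklore] -/
def twoPointSeq (x y : ℝ) (n : ℕ) : ℝ :=
  (n : ℝ) ^ (2 / 3 : ℝ) * μhalf.real (openConnIn halfLattice (bpt x n) (bpt y n))

/-- **(2;2) member, typed** (`e = (2,-1)`, `Σ h = 2/3`, pair exponent `-2/3`): the boundary
two-point connectivity law of bond-`ℤ²` percolation in the half-plane. Exponent = twice the
half-plane one-arm exponent (`HalfPlaneOneArmThird`, stmt-5662). [folklore] -/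
def HalfPlaneTwoPointLaw : Prop :=
  ∃ C : ℝ, 0 < C ∧ ∀ x y : ℝ, x < y →
    Tendsto (twoPointSeq x y) atTop (𝓝 (C * (y - x) ^ (-(2 / 3) : ℝ)))

/-- Member `(1,1;2)`: `n^{1/3} · P_{1/2}[(⌊xn⌋,0) ↔ [⌊an⌋,⌊bn⌋] × {0} in ℤ × ℕ]`. [folklore] -/
def arcPointSeq (a b x : ℝ) (n : ℕ) : ℝ :=
  (n : ℝ) ^ (1 / 3 : ℝ) * μhalf.real (openCrossing halfLattice (barc a b n) {bpt x n})

/-- **(1,1;2) member, typed** (`e = (1,1,-1)`, `Σ h = 1/3`): a THREE-point member, whose shape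
`(b-a)^{1/3} (x-a)^{-1/3} (x-b)^{-1/3}` is forced by Möbius covariance alone (weights `0, 0, 1/3`) —
the cheapest direct test of conformal covariance of a boundary correlator on `ℤ²`. [folklore] -/
def HalfPlaneArcPointLaw : Prop :=
  ∃ C : ℝ, 0 < C ∧ ∀ a b x : ℝ, a < b → b < x →
    Tendsto (arcPointSeq a b x) atTop
      (𝓝 (C * (b - a) ^ (1 / 3 : ℝ) * ((x - a) * (x - b)) ^ (-(1 / 3) : ℝ)))

/-- Member `(1,1,1;3)`: the mark density `n · P_{1/2}[(⌊xn⌋,0)` is the `c`-most vertex of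
`[⌊cn⌋, ∞) × {0}` joined in `ℤ × ℕ` to `[⌊an⌋,⌊bn⌋] × {0}]` (the event of stmt-5661 verbatim).
[folklore] -/
def markDensitySeq (a b c x : ℝ) (n : ℕ) : ℝ :=
  (n : ℝ) * μhalf.real (openCrossing halfLattice (barc a b n) {bpt x n}
      \ openCrossing halfLattice (barc a b n) {v | v 1 = 0 ∧ ⌊c * n⌋ ≤ v 0 ∧ v 0 < ⌊x * n⌋})

/-- **(1,1,1;3) member, typed** (`e = (1,1,1,-2)`, `Σ h = 1`): the SHAPE of
`HalfPlaneMarkDensityLaw` with a free constant `C` (the crux's `C(L,s; realisation)`). [folklore] -/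
def HalfPlaneMarkDensityShape : Prop :=
  ∃ C : ℝ, 0 < C ∧ ∀ a b c x : ℝ, a < b → b < c → c < x →
    Tendsto (markDensitySeq a b c x) atTop
      (𝓝 (C * ((b - a) * (c - b) * (c - a)) ^ (1 / 3 : ℝ)
        * ((x - a) * (x - b) * (x - c)) ^ (-(2 / 3) : ℝ)))

/-- The typed sibling stmt-5661 is the instance `C = cardyConst/3` of the (1,1,1;3) member.
[folklore] -/
theorem markDensityShape_of_law
    (h : Summit.CriticalPhenomena.CardyFormulaZ2.Theses.CardyBoundaryCoulombGas.HalfPlaneMarkDensityLaw) :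
    HalfPlaneMarkDensityShape :=
  ⟨cardyConst / 3, div_pos cardyConst_pos (by norm_num),
    fun a b c x hab hbc hcx => h a b c x hab hbc hcx⟩

/-! ### §4 Natural strengthenings, refuted -/

/-- The renormalised two-point sequence is at most `n^{2/3}` (a probability is `≤ 1`). [folklore] -/
theorem twoPointSeq_le (x y : ℝ) (n : ℕ) : twoPointSeq x y n ≤ (n : ℝ) ^ (2 / 3 : ℝ) := by
  unfold twoPointSeq
  have h1 : μhalf.real (openConnIn halfLattice (bpt x n) (bpt y n)) ≤ 1 := measureReal_le_one
  have h0 : 0 ≤ (n : ℝ) ^ (2 / 3 : ℝ) := by positivity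
  nlinarith

/-- STRENGTHENING: the (2;2) law uniformly on the whole configuration set `{x < y}` (not only
locally uniformly). [folklore] -/
def HalfPlaneTwoPointLawUniform : Prop :=
  ∃ C : ℝ, 0 < C ∧
    TendstoUniformlyOn (fun (n : ℕ) (p : ℝ × ℝ) => twoPointSeq p.1 p.2 n)
      (fun p => C * (p.2 - p.1) ^ (-(2 / 3) : ℝ)) atTop {p | p.1 < p.2}

/-- **Refuted strengthening**: the (2;2) law cannot hold uniformly up to the diagonal — at fixed
mesh the left side is bounded by `n^{2/3}` while the claimed limit blows up as `y ↓ x`. So the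
"locally uniformly" of the crux cannot be upgraded, and any integration of a member up to a
coincidence point (the route's DensityIntegration step) needs a separate a-priori bound near the
diagonal (RSW tightness), not the local law. Uses only `P ≤ 1`. [folklore] -/
theorem not_halfPlaneTwoPointLawUniform : ¬ HalfPlaneTwoPointLawUniform := by
  rintro ⟨C, hC, h⟩
  rw [Metric.tendstoUniformlyOn_iff] at h
  obtain ⟨N, hN⟩ := (h 1 one_pos).exists
  set M : ℝ := (N : ℝ) ^ (2 / 3 : ℝ) + 1 with hM
  have hMpos : 0 < M := by positivity
  set y : ℝ := (C / (2 * M)) ^ (3 / 2 : ℝ) with hy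
  have hypos : 0 < y := by positivity
  have hlim : C * (y - 0) ^ (-(2 / 3) : ℝ) = 2 * M := by
    rw [sub_zero, hy, ← Real.rpow_mul (by positivity : (0:ℝ) ≤ C / (2 * M))]
    norm_num
    rw [Real.rpow_neg_one]
    field_simp
  have hNy := hN ((0 : ℝ), y) (show ((0 : ℝ), y).1 < ((0 : ℝ), y).2 from hypos)
  rw [Real.dist_eq, abs_lt] at hNy
  have hle := twoPointSeq_le 0 y N
  simp only at hNy
  rw [hlim] at hNy
  linarith [hNy.2]

/-! #### §4b A lattice inequality every limit shape must satisfy — and the claimed one passes -/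

/-- Splitting a boundary arc: `[⌊an⌋,⌊cn⌋] ⊆ [⌊an⌋,⌊bn⌋] ∪ [⌊bn⌋,⌊cn⌋]`. [folklore] -/
theorem barc_subset_union (a b c : ℝ) (n : ℕ) : barc a c n ⊆ barc a b n ∪ barc b c n := by
  intro v hv
  rcases hv with ⟨h1, h2, h3⟩
  rcases le_total (v 0) ⌊b * n⌋ with h | h
  · exact Or.inl ⟨h1, h2, h⟩
  · exact Or.inr ⟨h1, h, h3⟩

/-- Open crossings from a union of sources. [folklore] -/
theorem openCrossing_union_subset {V : Type*} (S A₁ A₂ B : Set V) :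
    openCrossing S (A₁ ∪ A₂) B ⊆ openCrossing S A₁ B ∪ openCrossing S A₂ B := by
  rintro ω ⟨x, hx, y, hy, hω⟩
  rcases hx with hx | hx
  · exact Or.inl ⟨x, hx, y, hy, hω⟩
  · exact Or.inr ⟨x, hx, y, hy, hω⟩

/-- Open crossings are monotone in the source set. [folklore] -/
theorem openCrossing_mono_left {V : Type*} (S : Set V) {A A' : Set V} (h : A ⊆ A') (B : Set V) :
    openCrossing S A B ⊆ openCrossing S A' B := by
  rintro ω ⟨x, hx, y, hy, hω⟩
  exact ⟨x, h hx, y, hy, hω⟩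

/-- **Lattice union bound for the (1,1;2) member** (exact, every mesh):
`P[x ↔ [a,c]] ≤ P[x ↔ [a,b]] + P[x ↔ [b,c]]`. [folklore] -/
theorem arcPointSeq_union_le (a b c x : ℝ) (n : ℕ) :
    arcPointSeq a c x n ≤ arcPointSeq a b x n + arcPointSeq b c x n := by
  unfold arcPointSeq
  rw [← mul_add]
  refine mul_le_mul_of_nonneg_left ?_ (by positivity)
  calc μhalf.real (openCrossing halfLattice (barc a c n) {bpt x n})
      ≤ μhalf.real (openCrossing halfLattice (barc a b n) {bpt x n}
          ∪ openCrossing halfLattice (barc b c n) {bpt x n}) := by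
        refine measureReal_mono ?_ (measure_ne_top _ _)
        exact (openCrossing_mono_left _ (barc_subset_union a b c n) _).trans
          (openCrossing_union_subset _ _ _ _)
    _ ≤ _ := measureReal_union_le _ _

/-- Hence ANY limit shape of the (1,1;2) member is subadditive under splitting the arc: if
`n^{1/3} P[x ↔ [a,b]] → F a b x` for all `a < b < x` then `F a c x ≤ F a b x + F b c x`.
A rigorous constraint (no percolation input beyond the union bound). [folklore] -/
theorem limitShape_subadditive {F : ℝ → ℝ → ℝ → ℝ}
    (h : ∀ a b x : ℝ, a < b → b < x → Tendsto (arcPointSeq a b x) atTop (𝓝 (F a b x)))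
    {a b c x : ℝ} (hab : a < b) (hbc : b < c) (hcx : c < x) :
    F a c x ≤ F a b x + F b c x :=
  le_of_tendsto_of_tendsto (h a c x (hab.trans hbc) hcx)
    ((h a b x hab (hbc.trans hcx)).add (h b c x hbc hcx))
    (Eventually.of_forall fun n => arcPointSeq_union_le a b c x n)

/-- Harmonic-measure additivity behind the claimed (1,1;2) shape:
`(c-a)/((x-a)(x-c)) = (b-a)/((x-a)(x-b)) + (c-b)/((x-b)(x-c))`. [folklore] -/
theorem hm_additive {a b c x : ℝ} (hxa : x ≠ a) (hxb : x ≠ b) (hxc : x ≠ c) :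
    (c - a) / ((x - a) * (x - c)) = (b - a) / ((x - a) * (x - b)) + (c - b) / ((x - b) * (x - c)) := by
  have ha : x - a ≠ 0 := sub_ne_zero.2 hxa
  have hb : x - b ≠ 0 := sub_ne_zero.2 hxb
  have hc : x - c ≠ 0 := sub_ne_zero.2 hxc
  field_simp
  ring

/-- **The claimed (1,1;2) shape PASSES the union-bound constraint** (strictly inside):
`((c-a)/((x-a)(x-c)))^{1/3} ≤ ((b-a)/((x-a)(x-b)))^{1/3} + ((c-b)/((x-b)(x-c)))^{1/3}` for
`a < b < c < x`, by additivity of harmonic measure and subadditivity of `t ↦ t^{1/3}`. So this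
cheap lattice inequality does not refute the crux; it is recorded as a constraint every candidate
limit must meet. [folklore] -/
theorem claimedShape_passes_union_bound {a b c x : ℝ} (hab : a < b) (hbc : b < c) (hcx : c < x) :
    ((c - a) / ((x - a) * (x - c))) ^ (1 / 3 : ℝ)
      ≤ ((b - a) / ((x - a) * (x - b))) ^ (1 / 3 : ℝ) + ((c - b) / ((x - b) * (x - c))) ^ (1 / 3 : ℝ) := by
  have hxa : a < x := hab.trans (hbc.trans hcx)
  have hxb : b < x := hbc.trans hcx
  rw [hm_additive hxa.ne' hxb.ne' hcx.ne']
  exact Real.rpow_add_le_add_rpow (by positivity) (by positivity) (by norm_num) (by norm_num)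

/-- The claimed shape, written with the product power as in `HalfPlaneArcPointLaw`, equals the
harmonic-measure form used above (for `a < b < x`). [folklore] -/
theorem claimedShape_eq {C a b x : ℝ} (hab : a < b) (hbx : b < x) :
    C * (b - a) ^ (1 / 3 : ℝ) * ((x - a) * (x - b)) ^ (-(1 / 3) : ℝ)
      = C * ((b - a) / ((x - a) * (x - b))) ^ (1 / 3 : ℝ) := by
  have h1 : 0 < b - a := sub_pos.2 hab
  have h2 : 0 < (x - a) * (x - b) := mul_pos (sub_pos.2 (hab.trans hbx)) (sub_pos.2 hbx)
  rw [Real.div_rpow h1.le h2.le, Real.rpow_neg h2.le]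
  ring

/-! ### §5 Load-bearing hypotheses — what breaks when each is dropped (paper analysis; evidence level stated)

Legend: [L] = certified in Lean above; [T] = theorem in print (triangular lattice / general);
[P] = physics-level (CFT/Coulomb gas); [C] = computed (this seat or predecessors).

* H-neutral `Σ s_i L_i = 0` with ONE sink (⇔ `Σ e_i = 1`). Drop it ⇒ two failure modes:
  (a) `Σ e ∉ {0,1}`: the conclusion is frame-DEPENDENT, so the statement (quantified over all
  uniformizing `w`) is false for every lattice model whatsoever [L: `not_lawInAllDilatedFrames…`];
  (b) label vectors with `Σe = 1` but not of rainbow-with-one-sink type are not realisable: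
  `Z[ins] ≡ 0` at every mesh (F3 census of stmt-6947: 38 of 48 neutral vectors, `k ≤ 5` [C,
  predecessors]) while the claimed limit is `> 0`. So "exactly one sink" is load-bearing twice.
* H-sinklabel `e_sink = 1 - L` (not `-L`). The alternative is inconsistent [L:
  `not_lawInAllMoebiusFrames_naiveSink`]; `hw_eq_hw_iff` shows `{L, 1-L}` are the only labels with
  the `L`-leg weight, and `Σe = 1` then picks `1-L` at exactly one insertion. Any proof must produce
  the linear (background-charge) term; a pure "stiffness" evaluation of the jump energies cannot [P:
  route text, Jacobsen 2009 (14.76)–(14.79)].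
* H-noncorner `x_i` off the corners. At a corner of interior angle `θ` a boundary operator of weight
  `h` scales with exponent `(π/θ)·h` (Cardy 1984 corner operators; for percolation arms in a wedge the
  one-arm exponent is `π/(3θ)` [T on the triangular lattice via SLE₆/Smirnov–Werner-type arguments;
  P in general]); e.g. an `L = 2` insertion AT a convex corner (`θ = π/2`) has exponent `2/3`, so
  `δ^{-1/3}·P → 0`, not `C·(…) > 0`: the normalisation `δ^{-Σh(e_i)}` is false at corners. Corners
  of `Ω` away from the insertions enter only through `w` (and `|w′| → 0/∞` there, F4 of 6947).
* H-rectilinear `∂Ω` axis-parallel. For a general Jordan/smooth `Ω` the lattice boundary of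
  `Ω̄ ∩ δℤ²` near `x_i` is a staircase whose local statistics depend on the slope of `∂Ω` at `x_i`:
  the non-universal constant becomes `C(slope at each x_i)` and, for irrational slopes, need not
  converge at all along `δ → 0` (the environment of `x_i^δ` does not stabilise) [P; standard
  lattice-amplitude lore]. So "C independent of Ω and (x_i)" genuinely uses that every non-corner
  boundary point of a rectilinear `Ω_δ` sees the same half-plane `ℤ × ℕ` up to a symmetry of `ℤ²`
  (the dihedral group `D₄` IS a symmetry of `ℤ²`: this is where the square lattice is used).
* H-onto `w : Ω → ℍ` must be a conformal ISOMORPHISM onto `ℍ` (a uniformizing map), not a conformal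
  map into `ℍ`: for `w₂ = u + u²/2`, `u = -1/(w₁ + i)` (holomorphic, injective, `ℍ → ℍ`, not Möbius)
  the right-hand sides for `w₁` and `w₂` differ (e.g. member (2;2) at `w₁(x), w₁(y) = 0, 1`: ratio
  `(9/8)^{-1/3} ≠ 1`), so an "into" typing is refuted by `frames_template` [L-template + arithmetic].
  The tree's `ConformalEquiv upperHalfPlaneSet _` (Literature…ConformalRectangle) has onto built in —
  USE IT when typing; and type `∃ C, ∀ Ω ∀ ins ∀ (φ, x) uniformizing`, never `∀ w ∃ C`.
* H-finite `w(x_i) ≠ ∞`: otherwise the product is meaningless (needs the transformed chart) — keep.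
* H-localunif "locally uniformly in admissible `(x_i)`" cannot be strengthened to "uniformly" [L:
  `not_halfPlaneTwoPointLawUniform`]; it also cannot reach the corners (previous bullet).
* H-k `k ≥ 2`: with one sink and `L_i ≥ 1`, `k = 1` is impossible (`Σ s_i L_i = -L ≠ 0`); the clause
  is implied, harmless. `k = 2`, `L = (1;1)`: the event is trivial (`Z[ins]/Z = 1`, wired arc), the
  claim reads `1 → C`: true with `C = 1` — a useful unit test for any typed version.
* H-realisation "C depends on the lattice realisation of the insertions": necessary — e.g. realising an
  `L = 2` source as a pinned cluster at one vertex versus at a 2-cell window changes `C` by an `O(1)`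
  factor but not the shape (standard; [C] could be read off j008099-type runs with two realisations).

### §6 Why it resists, and what a refutation would have to look like

1. Below the asymptotics there is nothing to refute: `Z[ins]/Z = P[R(ins)]` is an identity of the
   definition (planner enumeration; for `(2;2)` the jump-by-2 collar at a boundary vertex `v` emits the
   two hull strands of the cluster pinned at `v`, so `R = {x ↔ y}`; for odd `L` the collar switches
   free/wired and the strand is the b.c.c. hull — reconstructed here from the height rules, consistent
   with the planner's three verified instances).
2. At the continuum level the right-hand side is the unique frame-consistent pure product with the
   Kac weights (§1–§2), it satisfies the level-2/3 BPZ equations at marks / 2-leg points (rattack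
   cg_checks, 25 families) and has the correct leading exponent in EVERY pairwise fusion channel
   (checked by hand this cycle for `(1,1,1;3)`, `(1,1,1,1;4)`, `(2,1,1;4)`, `(2,2;4)`: each boundary
   collision reproduces `h(a+b)-h(a)-h(b) = ab/3`, i.e. the rainbow = maximal channel), and for the
   3-point members it is forced by covariance alone. A paper refutation therefore needs either
   (i) a rainbow family whose lattice event is NOT the maximal channel (none found: the forced nesting
   makes every partial fusion maximal), or (ii) a logarithmic partner mixing into a rainbow operator
   (c = 0 LCFT): excluded for the `δ`-normalisation of `L = 3, 4` by the universal half-plane arm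
   estimates `P ≍ δ^{1}, δ^{2}` WITHOUT logs (β₂⁺ = 1, β₃⁺ = 2, up-to-constants theorems on `ℤ²`),
   and not expected elsewhere; or (iii) failure of conformal covariance on `ℤ²` itself (Zhang
   arXiv:2206.04599 claims ¬Cardy on `ℤ²`; unrefereed, contradicted by all numerics incl. §7).
3. Hence the crux is "open-problem" grade: its (1,1,1;3) member on `ℤ × ℕ` is EQUIVALENT, up to the
   local regularity of a monotone difference quotient, to Cardy's formula for half-plane 4-point
   crossings (`Σ_x P(E_x)` telescopes to crossing probabilities exactly), and its (2;2) member contains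
   the half-plane one-arm exponent `1/3` (stmt-5662) plus a ratio-limit theorem. Disproving it would
   disprove conformal invariance of critical bond percolation on `ℤ²`.

### §7 Numerics — EXACT transfer matrices for member (2;2) on strips (this seat; `TM-NUMERICS.md`, scripts `tm2/main.py`, `tm3.py`, `tm/main.py` attached to the item) and a pending Monte Carlo (kit j008720)

All exact (floating point, no sampling), bond percolation `p = 1/2`; `n_e := π/(3γ_n)` is the effective
width read off the decay rate `γ_n` of the strip of `n+1` rows (`n_e = n + a`, `a → 1.40`; `n γ_n` = the
planner's j005323 values to all digits).
(A) Bi-infinite strip `ℤ × {0..n}`, both points on the bottom wall (or one on each wall): the crux with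
    `w = exp(πz/n_e)` predicts `P_b(r) ≈ C (π/2n_e)^{2/3} sinh(πr/2n_e)^{-2/3}`, `P_t` idem with `cosh`,
    hence amplitude `A_n = C (3γ_n)^{2/3}` with ONE `C` for all `n` (the half-plane constant), whereas
    without the `|w′|^{1/3}` factors `A_n` would not depend on `n`. Found: `A_n` = 0.819, 0.680, 0.584,
    0.515, 0.462, 0.421, 0.388, 0.360, 0.337 (n = 1..9) and `C_est(n) = A_n/(3γ_n)^{2/3}` = 0.6977,
    0.7239, 0.7351, 0.7408, 0.7440, 0.7461, 0.7474, 0.7483, 0.7490 (increments ~ n^{-5/2}) →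
    `C = 0.752 ± 0.004`; `A_top = A_bottom` to all
    digits; at `n = 7` the full shapes `P_b/pred`, `P_t/pred` equal 1 to ≤ 1e-3 for every `r ≥ 6` and
    `P_t/P_b = tanh(πr/2n_e)^{2/3}` to ≤ 1e-3 for `r ≥ 8` (two fitted numbers `n_e`, `C` only).
(B) Semi-infinite strip (a convex CORNER at the end wall): amplitude of `P[(s,0) ↔ (r,0)]`, `r → ∞`, as a
    function of the distance `s` to the end wall. Crux with `w = cosh(πz/n_e)`:
    `A(s)/A(∞) = (1 - e^{-2π(s+o)/n_e})^{1/3}` with the end wall `o = a/2` outside column 0 (NO free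
    parameter). Found (n = 7): s = 1: 0.8988 vs 0.8962; s = 2: 0.9532 vs 0.9537; s = 3: 0.9779 vs 0.9786;
    s = 4: 0.9894 vs 0.9900; all `s ≥ 1`, all `n ≤ 7`: agreement ≤ 0.3 %. This is the `|w′(x)|^{1/3}`
    law along a wall running into a convex corner (`|w′| → 0`) — the planner's "corner covariance"
    falsifier, done exactly: PASSED.
(C) Corners themselves (excluded by the crux, cf. H-noncorner): both points AT the bottom corners of the
    rectangle `[0,r] × [0,n]`: `A_n n_e^{2/3}` is NOT constant (1.40 → 0.90, n = 1..8); the local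
    exponent `d log A/d log n_e` = −0.81, −0.94, −1.03, −1.08, −1.12, −1.14, −1.17 drifts towards
    `-4/3 = -2·(π/θ)·h(2)`, `θ = π/2` (fit `e_∞ + c/n_e`: `e_∞ = -1.34`); one corner point + one wall
    point (B at `s = 0`): exponent → `-1 = -(2/3 + 1/3)`. So at corners the normalisation exponent of the
    crux changes — the non-corner clause is load-bearing, numerically.
(E) Boundary ONE-ARM across the strip (exact, `tm4b.py`): `T_n = P[(0,0) ↔ top wall anywhere]` in
    `ℤ × {0..n}`. The (1,1;2) member with the arc = the whole top wall predicts `T_n ≈ C₁₂ (π/n_e)^{1/3}`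
    (weight `h(2) = 1/3` = the half-plane one-arm exponent of stmt-5662). Found (n = 1..6): local exponents
    `-d log T/d log n_e` = 0.432, 0.399, 0.382, 0.372, 0.365 → `1/3`, and `T_n n_e^{1/3}` = 1.051, 1.018,
    1.001, 0.991, 0.985, 0.980 (settling). CONTROL: the corner version `T_left = P[(0,0) ↔ top wall within
    the half-strip of columns ≤ 0]` (the point is then a corner of that half-strip) has local exponents
    0.813, 0.785, 0.761, 0.743, 0.730 → `2/3 = (π/θ)·(1/3)`: the same wall/corner dichotomy as (B)/(C).
(D) Pending: kit j008720 (Monte Carlo, half-strip `W = 192`: (2;2) for 289 boundary points incl.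
    cross-corner pairs, (1,1;2) shapes, (1,1,1;3) density across a corner). PREDICTION from (A):
    `lim r^{2/3} P_{ℤ×ℕ}[(0,0) ↔ (r,0)] = 0.752 ± 0.004`. The kit queue held 4214 jobs at priority ≥ 88
    (this seat: 79) all session; the result will be folded in at the next re-arm.
VERDICT of §7: the (2;2) member's conformal-covariance structure (exponent `2h(2) = 2/3`, the
`|w′|^{1/3}` factors, strip ↔ half-plane ↔ half-strip) is confirmed on `ℤ²` at the 1e-3 level; the
numerics support the crux and cannot refute it.

### §8 Targets and near-misses

No line has been picked for this crux (`payload.targets = []`, no `Lines/`), so there are no stub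
targets yet. Near-misses: none claimed — every Lean statement above is closed; the would-be tightness
lemma "`HalfPlaneMarkDensityShape` with constant `C` ⇒ `C ≤ cardyConst/3`" (disjointness of the
events `E_x` + Fatou + `PureProductIntegrates`) is recorded as the next Lean target, not attempted.
-/

local notation "cardyF" => Literature.Probability.RandomPlanarGeometry.cardyFunction

/-! ### §9 (cycle 2) The constant of member (i) is capped: `C ≤ cardyConst/3`, unconditionally -/

/-- The claimed shape of member (i): `Δ(a,b,c)^{1/3} ((x-a)(x-b)(x-c))^{-2/3}`. [folklore] -/
def shapeFun (a b c x : ℝ) : ℝ :=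
  ((b - a) * (c - b) * (c - a)) ^ (1 / 3 : ℝ) * ((x - a) * (x - b) * (x - c)) ^ (-(2 / 3) : ℝ)

/-- Member (i) with a PRESCRIBED constant `C` (cf. `HalfPlaneMarkDensityShape` = `∃ C > 0, …`, §3). [folklore] -/
def HalfPlaneMarkDensityShapeWith (C : ℝ) : Prop :=
  ∀ a b c x : ℝ, a < b → b < c → c < x →
    Tendsto (markDensitySeq a b c x) atTop (𝓝 (C * shapeFun a b c x))

/-- The lattice mark event at integer abscissa `j` with integer threshold `j₀`:
`{(j,0) ↔ A} ∖ {[j₀, j) × {0} ↔ A}` ("`(j,0)` is the `j₀`-most vertex joined to `A`"). [folklore] -/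
def markEvent (A : Set (Site 2)) (j₀ j : ℤ) : Set (BondConfig (Site 2)) :=
  openCrossing halfLattice A {![j, 0]}
    \ openCrossing halfLattice A {v | v 1 = 0 ∧ j₀ ≤ v 0 ∧ v 0 < j}

/-- The mark density in terms of `markEvent`. [folklore] -/
theorem markDensitySeq_eq (a b c x : ℝ) (n : ℕ) :
    markDensitySeq a b c x n = (n : ℝ) * μhalf.real (markEvent (barc a b n) ⌊c * n⌋ ⌊x * n⌋) := rfl

/-- Mark events are measurable (countable vertex set). [folklore] -/
theorem measurableSet_markEvent (A : Set (Site 2)) (j₀ j : ℤ) : MeasurableSet (markEvent A j₀ j) :=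
  (measurableSet_openCrossing_of_countable _ _ _).diff (measurableSet_openCrossing_of_countable _ _ _)

/-- Mark events at distinct abscissae `j < j'` above the threshold are disjoint. [folklore] -/
theorem disjoint_markEvent (A : Set (Site 2)) {j₀ j j' : ℤ} (h₀ : j₀ ≤ j) (h : j < j') :
    Disjoint (markEvent A j₀ j) (markEvent A j₀ j') := by
  rw [Set.disjoint_left]
  rintro ω ⟨⟨x, hx, y, hy, hω⟩, -⟩ ⟨-, hω'⟩
  refine hω' ⟨x, hx, y, ?_, hω⟩
  rw [Set.mem_singleton_iff] at hy
  subst hy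
  exact ⟨by simp, by simpa using h₀, by simpa using h⟩

/-- **Exact lattice constraint**: the mark events partition (part of) a crossing event, so their
probabilities over any finite set of abscissae above the threshold sum to at most `1`. [folklore] -/
theorem sum_real_markEvent_le_one (A : Set (Site 2)) (j₀ : ℤ) (S : Finset ℤ) (hS : ∀ j ∈ S, j₀ ≤ j) :
    ∑ j ∈ S, μhalf.real (markEvent A j₀ j) ≤ 1 := by
  rw [← measureReal_biUnion_finset]
  · exact measureReal_le_one
  · intro j hj j' hj' hne
    rcases lt_or_gt_of_ne hne with h | h
    · exact disjoint_markEvent A (hS j hj) h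
    · exact (disjoint_markEvent A (hS j' hj') h).symm
  · exact fun j _ => measurableSet_markEvent A j₀ j

/-- A wall vertex is determined by its abscissa. [folklore] -/
theorem eq_vec_of_wall {v : Site 2} (hv : v 1 = 0) : v = ![v 0, 0] := by
  ext i; fin_cases i
  · rfl
  · simpa using hv

/-- **Exact partition identity** (every mesh): the mark events `E_j`, `j₀ ≤ j ≤ J`, partition the
crossing event `{A ↔ [j₀, J] × {0}}` — "`Σ_x m_δ(x)` IS the crossing probability", the lattice identity
behind the route's DensityIntegration step and behind §9's cap. [folklore] -/
theorem biUnion_markEvent (A : Set (Site 2)) (j₀ J : ℤ) :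
    (⋃ j ∈ Finset.Icc j₀ J, markEvent A j₀ j)
      = openCrossing halfLattice A {v | v 1 = 0 ∧ j₀ ≤ v 0 ∧ v 0 ≤ J} := by
  ext ω
  simp only [Set.mem_iUnion, Finset.mem_Icc, exists_prop]
  constructor
  · rintro ⟨j, ⟨hj₀, hjJ⟩, ⟨x, hx, y, hy, hω⟩, -⟩
    rw [Set.mem_singleton_iff] at hy
    subst hy
    exact ⟨x, hx, _, ⟨by simp, by simpa using hj₀, by simpa using hjJ⟩, hω⟩
  · rintro ⟨x, hx, y, ⟨hy1, hy0, hyJ⟩, hω⟩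
    -- the set of good abscissae is nonempty; take its least element
    classical
    let S : Finset ℤ := (Finset.Icc j₀ J).filter fun j => ω ∈ openCrossing halfLattice A {![j, 0]}
    have hyS : y 0 ∈ S := by
      refine Finset.mem_filter.2 ⟨Finset.mem_Icc.2 ⟨hy0, hyJ⟩, x, hx, ![y 0, 0], rfl, ?_⟩
      rwa [← eq_vec_of_wall hy1]
    have hS : S.Nonempty := ⟨_, hyS⟩
    refine ⟨S.min' hS, ?_, ?_⟩
    · have hm := Finset.min'_mem S hS
      exact Finset.mem_Icc.1 (Finset.mem_filter.1 hm).1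
    · refine ⟨(Finset.mem_filter.1 (Finset.min'_mem S hS)).2, ?_⟩
      rintro ⟨x', hx', y', ⟨hy'1, hy'0, hy'lt⟩, hω'⟩
      have hy'S : y' 0 ∈ S := by
        have hmJ : S.min' hS ≤ J := (Finset.mem_Icc.1 (Finset.mem_filter.1 (Finset.min'_mem S hS)).1).2
        refine Finset.mem_filter.2 ⟨Finset.mem_Icc.2 ⟨hy'0, by omega⟩, x', hx', ![y' 0, 0], rfl, ?_⟩
        rwa [← eq_vec_of_wall hy'1]
      exact absurd (Finset.min'_le S _ hy'S) (not_le.2 hy'lt)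

/-- Hence, exactly: `Σ_{j₀ ≤ j ≤ J} P(E_j) = P[A ↔ [j₀, J] × {0} in ℤ × ℕ]`. [folklore] -/
theorem sum_real_markEvent_eq (A : Set (Site 2)) (j₀ J : ℤ) :
    ∑ j ∈ Finset.Icc j₀ J, μhalf.real (markEvent A j₀ j)
      = μhalf.real (openCrossing halfLattice A {v | v 1 = 0 ∧ j₀ ≤ v 0 ∧ v 0 ≤ J}) := by
  rw [← biUnion_markEvent, measureReal_biUnion_finset]
  · intro j hj j' hj' hne
    rcases lt_or_gt_of_ne hne with h | h
    · exact disjoint_markEvent A (Finset.mem_Icc.1 (Finset.mem_coe.1 hj)).1 h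
    · exact (disjoint_markEvent A (Finset.mem_Icc.1 (Finset.mem_coe.1 hj')).1 h).symm
  · exact fun j _ => measurableSet_markEvent A j₀ j

/-- In the crux's variables: at mesh `1/n`, the Riemann sum of the mark density over the lattice
points of `[c, X]` IS the crossing probability `P[[⌊an⌋,⌊bn⌋] ↔ [⌊cn⌋, ⌊Xn⌋]]` (no error term).
So member (i) + tightness at the lattice scale and at the marks ⇒ half-plane Cardy for these arcs,
and conversely half-plane Cardy pins the constant (cf. `constant_le_of_markDensityShapeWith`). [folklore] -/
theorem riemannSum_markDensity_eq (a b c X : ℝ) (n : ℕ) (hn : 1 ≤ n) :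
    (1 / (n : ℝ)) * ∑ j ∈ Finset.Icc ⌊c * n⌋ ⌊X * n⌋, (n : ℝ) * μhalf.real (markEvent (barc a b n) ⌊c * n⌋ j)
      = μhalf.real (openCrossing halfLattice (barc a b n) {v | v 1 = 0 ∧ ⌊c * n⌋ ≤ v 0 ∧ v 0 ≤ ⌊X * n⌋}) := by
  have hn' : (n : ℝ) ≠ 0 := by exact_mod_cast Nat.one_le_iff_ne_zero.1 hn
  rw [← Finset.mul_sum, ← mul_assoc, one_div_mul_cancel hn', one_mul, sum_real_markEvent_eq]

/-! #### Step B: Fatou — any pointwise limit shape integrates to at most `1` -/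

/-- The renormalised mark density as a step function of the continuum abscissa, cut off to
`(c', X]`, with values in `ℝ≥0∞`. [folklore] -/
def gStep (a b c c' X : ℝ) (n : ℕ) (x : ℝ) : ℝ≥0∞ :=
  (Set.Ioc c' X).indicator (fun x => ENNReal.ofReal (markDensitySeq a b c x n)) x

/-- Measurability in the continuum abscissa (a step function). [folklore] -/
theorem measurable_markDensitySeq (a b c : ℝ) (n : ℕ) :
    Measurable fun x : ℝ => markDensitySeq a b c x n := by
  have h1 : Measurable fun x : ℝ => ⌊x * (n : ℝ)⌋ :=
    Int.measurable_floor.comp (measurable_id.mul_const _)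
  have h2 : Measurable fun j : ℤ => (n : ℝ) * μhalf.real (markEvent (barc a b n) ⌊c * n⌋ j) :=
    measurable_of_countable _
  exact h2.comp h1

/-- Measurability of the cut-off step function. [folklore] -/
theorem measurable_gStep (a b c c' X : ℝ) (n : ℕ) : Measurable (gStep a b c c' X n) :=
  (ENNReal.measurable_ofReal.comp (measurable_markDensitySeq a b c n)).indicator measurableSet_Ioc

/-- Pointwise bound of the step function by a finite sum of indicator functions of the lattice
cells `[j/n, (j+1)/n)`. [folklore] -/
theorem gStep_le_sum (a b c c' X : ℝ) {n : ℕ} (hn : 1 ≤ n) (x : ℝ) :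
    gStep a b c c' X n x ≤
      ∑ j ∈ Finset.Icc ⌊c' * n⌋ ⌊X * n⌋,
        (Set.Ico ((j : ℝ) / n) ((j + 1 : ℝ) / n)).indicator
          (fun _ => ENNReal.ofReal ((n : ℝ) * μhalf.real (markEvent (barc a b n) ⌊c * n⌋ j))) x := by
  unfold gStep
  by_cases hx : x ∈ Set.Ioc c' X
  · rw [Set.indicator_of_mem hx, markDensitySeq_eq]
    have hn' : (0 : ℝ) < n := by exact_mod_cast hn
    set j : ℤ := ⌊x * n⌋ with hj
    have hjmem : j ∈ Finset.Icc ⌊c' * (n : ℝ)⌋ ⌊X * (n : ℝ)⌋ := by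
      rw [Finset.mem_Icc]
      exact ⟨Int.floor_mono (by nlinarith [hx.1]), Int.floor_mono (by nlinarith [hx.2])⟩
    have hxcell : x ∈ Set.Ico ((j : ℝ) / n) ((j + 1 : ℝ) / n) := by
      rw [Set.mem_Ico, div_le_iff₀ hn', lt_div_iff₀ hn']
      exact ⟨Int.floor_le _, Int.lt_floor_add_one _⟩
    refine le_trans (le_of_eq ?_) (Finset.single_le_sum (f := fun (j : ℤ) =>
        (Set.Ico ((j : ℝ) / n) ((j + 1 : ℝ) / n)).indicator
          (fun _ => ENNReal.ofReal ((n : ℝ) * μhalf.real (markEvent (barc a b n) ⌊c * n⌋ j))) x)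
      (fun i _ => zero_le) hjmem)
    rw [Set.indicator_of_mem hxcell]
  · rw [Set.indicator_of_notMem hx]
    exact zero_le

/-- The lattice cells have Lebesgue measure `1/n`. [folklore] -/
theorem volume_cell (j : ℤ) {n : ℕ} (hn : 1 ≤ n) :
    volume (Set.Ico ((j : ℝ) / n) ((j + 1 : ℝ) / n)) = ENNReal.ofReal (1 / n) := by
  rw [Real.volume_Ico]
  congr 1
  have hn' : (n : ℝ) ≠ 0 := by exact_mod_cast (Nat.one_le_iff_ne_zero.1 hn)
  field_simp
  ring

/-- The integral of the step function is at most `1` at every mesh (lattice input: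
`sum_real_markEvent_le_one`). [folklore] -/
theorem lintegral_gStep_le_one (a b c c' X : ℝ) (hcc' : c < c') {n : ℕ} (hn : 1 ≤ n) :
    ∫⁻ x, gStep a b c c' X n x ≤ 1 := by
  have hn' : (0 : ℝ) < n := by exact_mod_cast hn
  calc ∫⁻ x, gStep a b c c' X n x
      ≤ ∫⁻ x, ∑ j ∈ Finset.Icc ⌊c' * n⌋ ⌊X * n⌋,
          (Set.Ico ((j : ℝ) / n) ((j + 1 : ℝ) / n)).indicator
            (fun _ => ENNReal.ofReal ((n : ℝ) * μhalf.real (markEvent (barc a b n) ⌊c * n⌋ j))) x :=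
        lintegral_mono fun x => gStep_le_sum a b c c' X hn x
    _ = ∑ j ∈ Finset.Icc ⌊c' * n⌋ ⌊X * n⌋,
          ENNReal.ofReal ((n : ℝ) * μhalf.real (markEvent (barc a b n) ⌊c * n⌋ j))
            * volume (Set.Ico ((j : ℝ) / n) ((j + 1 : ℝ) / n)) := by
        rw [lintegral_finsetSum]
        · refine Finset.sum_congr rfl fun j _ => ?_
          rw [lintegral_indicator_const measurableSet_Ico]
        · intro j _
          exact measurable_const.indicator measurableSet_Ico
    _ = ∑ j ∈ Finset.Icc ⌊c' * n⌋ ⌊X * n⌋,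
          ENNReal.ofReal (μhalf.real (markEvent (barc a b n) ⌊c * n⌋ j)) := by
        refine Finset.sum_congr rfl fun j _ => ?_
        rw [volume_cell j hn, ← ENNReal.ofReal_mul (by positivity)]
        congr 1
        field_simp
    _ = ENNReal.ofReal (∑ j ∈ Finset.Icc ⌊c' * n⌋ ⌊X * n⌋,
          μhalf.real (markEvent (barc a b n) ⌊c * n⌋ j)) :=
        (ENNReal.ofReal_sum_of_nonneg fun j _ => measureReal_nonneg).symm
    _ ≤ ENNReal.ofReal 1 := by
        refine ENNReal.ofReal_le_ofReal (sum_real_markEvent_le_one _ _ _ fun j hj => ?_)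
        rw [Finset.mem_Icc] at hj
        exact (Int.floor_mono (by nlinarith)).trans hj.1
    _ = 1 := ENNReal.ofReal_one

/-- **Fatou cap (lintegral form).** If member (i) holds with constant `C` then for all
`a < b < c < c' ≤ X`: `∫_{(c',X]} C · shape ≤ 1`. [folklore] -/
theorem lintegral_shape_le_one {C : ℝ} (h : HalfPlaneMarkDensityShapeWith C) {a b c c' X : ℝ}
    (hab : a < b) (hbc : b < c) (hcc' : c < c') :
    ∫⁻ x in Set.Ioc c' X, ENNReal.ofReal (C * shapeFun a b c x) ≤ 1 := by
  have hlim : ∀ x, Tendsto (fun n => gStep a b c c' X n x) atTop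
      (𝓝 ((Set.Ioc c' X).indicator (fun x => ENNReal.ofReal (C * shapeFun a b c x)) x)) := by
    intro x
    by_cases hx : x ∈ Set.Ioc c' X
    · simp only [gStep, Set.indicator_of_mem hx]
      exact (ENNReal.continuous_ofReal.tendsto _).comp (h a b c x hab hbc (hcc'.trans hx.1))
    · simp only [gStep, Set.indicator_of_notMem hx]
      exact tendsto_const_nhds
  have hfatou := lintegral_liminf_le (μ := volume) (u := atTop) (f := fun n => gStep a b c c' X n)
    (fun n => measurable_gStep a b c c' X n)
  have hleft : ∫⁻ x, liminf (fun n => gStep a b c c' X n x) atTop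
      = ∫⁻ x in Set.Ioc c' X, ENNReal.ofReal (C * shapeFun a b c x) := by
    rw [← lintegral_indicator measurableSet_Ioc]
    refine lintegral_congr fun x => ?_
    exact (hlim x).liminf_eq
  rw [← hleft]
  refine hfatou.trans ?_
  refine liminf_le_of_frequently_le (Eventually.frequently ?_)
  filter_upwards [eventually_ge_atTop 1] with n hn
  exact lintegral_gStep_le_one a b c c' X hcc' hn

/-! #### Step C: from the `lintegral` cap to a cap on the real integral over `[c', X]` -/

/-- The claimed shape is positive on admissible configurations. [folklore] -/
theorem shapeFun_pos {a b c x : ℝ} (hab : a < b) (hbc : b < c) (hcx : c < x) : 0 < shapeFun a b c x := by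
  unfold shapeFun
  have h1 : 0 < (b - a) * (c - b) * (c - a) := by
    have := sub_pos.2 hab; have := sub_pos.2 hbc; have := sub_pos.2 (hab.trans hbc); positivity
  have h2 : 0 < (x - a) * (x - b) * (x - c) := by
    have := sub_pos.2 (hab.trans (hbc.trans hcx)); have := sub_pos.2 (hbc.trans hcx)
    have := sub_pos.2 hcx; positivity
  exact mul_pos (Real.rpow_pos_of_pos h1 _) (Real.rpow_pos_of_pos h2 _)

/-- The claimed shape is continuous off the marks. [folklore] -/
theorem continuousAt_shapeFun {a b c x : ℝ} (hab : a < b) (hbc : b < c) (hcx : c < x) :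
    ContinuousAt (fun y => shapeFun a b c y) x := by
  unfold shapeFun
  have h2 : (x - a) * (x - b) * (x - c) ≠ 0 := by
    have := sub_pos.2 (hab.trans (hbc.trans hcx)); have := sub_pos.2 (hbc.trans hcx)
    have := sub_pos.2 hcx; positivity
  refine continuousAt_const.mul ?_
  exact ContinuousAt.rpow_const (by fun_prop) (Or.inl h2)

/-- Continuity on `[c', X]`, `c < c'`. [folklore] -/
theorem continuousOn_shapeFun {a b c c' X : ℝ} (hab : a < b) (hbc : b < c) (hcc' : c < c') :
    ContinuousOn (fun y => shapeFun a b c y) (Set.Icc c' X) :=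
  fun _ hx => (continuousAt_shapeFun hab hbc (hcc'.trans_le hx.1)).continuousWithinAt

/-- **Fatou cap (real form).** If member (i) holds with constant `C > 0` then
`C · ∫_{c'}^{X} shape ≤ 1` for all `a < b < c < c' ≤ X`. [folklore] -/
theorem integral_shape_le_one {C : ℝ} (hC : 0 < C) (h : HalfPlaneMarkDensityShapeWith C)
    {a b c c' X : ℝ} (hab : a < b) (hbc : b < c) (hcc' : c < c') (hc'X : c' ≤ X) :
    C * ∫ x in c'..X, shapeFun a b c x ≤ 1 := by
  have hcont : ContinuousOn (fun x => C * shapeFun a b c x) (Set.Icc c' X) :=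
    continuousOn_const.mul (continuousOn_shapeFun hab hbc hcc')
  have hint : IntegrableOn (fun x => C * shapeFun a b c x) (Set.Ioc c' X) :=
    (hcont.integrableOn_compact isCompact_Icc).mono_set Set.Ioc_subset_Icc_self
  have hnn : 0 ≤ᵐ[volume.restrict (Set.Ioc c' X)] fun x => C * shapeFun a b c x := by
    refine ae_restrict_of_forall_mem measurableSet_Ioc fun x hx => ?_
    exact (mul_pos hC (shapeFun_pos hab hbc (hcc'.trans hx.1))).le
  have key := lintegral_shape_le_one h hab hbc hcc' (X := X)
  rw [← ofReal_integral_eq_lintegral_ofReal hint hnn] at key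
  have key' : ∫ x in Set.Ioc c' X, C * shapeFun a b c x ≤ 1 := by
    have := (ENNReal.ofReal_le_ofReal_iff zero_le_one).1 (by simpa using key)
    exact this
  rwa [← intervalIntegral.integral_of_le hc'X, intervalIntegral.integral_const_mul] at key'

/-! #### Step D: the claimed shape is an exact derivative — `(cardyConst/3)·shape = d/dx F(η(a,b,c,x))` -/

/-- Cardy's cross-ratio of `(a, b, c, x)` as a rational function of the moving point `x`. [folklore] -/
def etaFun (a b c x : ℝ) : ℝ := (b - a) * (x - c) / ((c - a) * (x - b))

/-- `etaFun` IS the tree's `crossRatio ![a,b,c,x]`. [folklore] -/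
theorem crossRatio_eq_etaFun (a b c x : ℝ) :
    Literature.Probability.RandomPlanarGeometry.crossRatio ![a, b, c, x] = etaFun a b c x := by
  unfold Literature.Probability.RandomPlanarGeometry.crossRatio etaFun
  simp only [Matrix.cons_val_zero, Matrix.cons_val_one, Matrix.cons_val_two, Matrix.cons_val_three,
    Matrix.head_cons, Matrix.tail_cons]
  have h1 : (a - b) * (c - x) = (b - a) * (x - c) := by ring
  have h2 : (a - c) * (b - x) = (c - a) * (x - b) := by ring
  rw [h1, h2]

/-- `η(a,b,c,c) = 0`. [folklore] -/
theorem etaFun_self (a b c : ℝ) : etaFun a b c c = 0 := by simp [etaFun]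

/-- `0 < η` for `a < b < c < x`. [folklore] -/
theorem etaFun_pos {a b c x : ℝ} (hab : a < b) (hbc : b < c) (hcx : c < x) : 0 < etaFun a b c x := by
  unfold etaFun
  have := sub_pos.2 hab; have := sub_pos.2 hcx; have := sub_pos.2 (hab.trans hbc)
  have := sub_pos.2 (hbc.trans hcx)
  positivity

/-- `1 - η = (c-b)(x-a)/((c-a)(x-b))`. [folklore] -/
theorem one_sub_etaFun {a b c x : ℝ} (hca : c ≠ a) (hxb : x ≠ b) :
    1 - etaFun a b c x = (c - b) * (x - a) / ((c - a) * (x - b)) := by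
  unfold etaFun
  have h1 : c - a ≠ 0 := sub_ne_zero.2 hca
  have h2 : x - b ≠ 0 := sub_ne_zero.2 hxb
  field_simp
  ring

/-- `η < 1` for `a < b < c < x`. [folklore] -/
theorem etaFun_lt_one {a b c x : ℝ} (hab : a < b) (hbc : b < c) (hcx : c < x) : etaFun a b c x < 1 := by
  have h := one_sub_etaFun (a := a) (b := b) (c := c) (x := x) (hab.trans hbc).ne' (hbc.trans hcx).ne'
  have : 0 < (c - b) * (x - a) / ((c - a) * (x - b)) := by
    have := sub_pos.2 hbc; have := sub_pos.2 (hab.trans (hbc.trans hcx))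
    have := sub_pos.2 (hab.trans hbc); have := sub_pos.2 (hbc.trans hcx)
    positivity
  linarith

/-- `∂ₓη = (b-a)(c-b)/((c-a)(x-b)²)`. [folklore] -/
theorem hasDerivAt_etaFun {a b c x : ℝ} (hca : c ≠ a) (hxb : x ≠ b) :
    HasDerivAt (fun x => etaFun a b c x) ((b - a) * (c - b) / ((c - a) * (x - b) ^ 2)) x := by
  unfold etaFun
  have h1 : c - a ≠ 0 := sub_ne_zero.2 hca
  have h2 : x - b ≠ 0 := sub_ne_zero.2 hxb
  have hN : HasDerivAt (fun x : ℝ => (b - a) * (x - c)) (b - a) x := by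
    simpa using ((hasDerivAt_id x).sub_const c).const_mul (b - a)
  have hD : HasDerivAt (fun x : ℝ => (c - a) * (x - b)) (c - a) x := by
    simpa using ((hasDerivAt_id x).sub_const b).const_mul (c - a)
  refine (hN.div hD (mul_ne_zero h1 h2)).congr_deriv ?_
  rw [div_eq_div_iff (pow_ne_zero 2 (mul_ne_zero h1 h2)) (mul_ne_zero h1 (pow_ne_zero 2 h2))]
  ring

/-- The algebra of the chain rule: `F'(η) · η' = (cardyConst/3) · shape` — the identity behind
`PureProductIntegrates` (stmt-5664) and behind `HalfPlaneMarkDensityLaw = F'(η)∂ₓη`. [folklore] -/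
theorem cardyDeriv_mul_etaDeriv {a b c x : ℝ} (hab : a < b) (hbc : b < c) (hcx : c < x) :
    cardyConst / 3 * (etaFun a b c x * (1 - etaFun a b c x)) ^ (-(2 / 3 : ℝ))
        * ((b - a) * (c - b) / ((c - a) * (x - b) ^ 2))
      = cardyConst / 3 * shapeFun a b c x := by
  have hP : 0 < b - a := sub_pos.2 hab
  have hQ : 0 < c - b := sub_pos.2 hbc
  have hR : 0 < c - a := sub_pos.2 (hab.trans hbc)
  have hU : 0 < x - a := sub_pos.2 (hab.trans (hbc.trans hcx))
  have hV : 0 < x - b := sub_pos.2 (hbc.trans hcx)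
  have hW : 0 < x - c := sub_pos.2 hcx
  have h1 : c - a ≠ 0 := hR.ne'
  have h2 : x - b ≠ 0 := hV.ne'
  have hM : etaFun a b c x * (1 - etaFun a b c x)
      = ((b - a) * (c - b) * (x - a) * (x - c)) / ((c - a) * (x - b)) ^ 2 := by
    rw [one_sub_etaFun (hab.trans hbc).ne' (hbc.trans hcx).ne']
    unfold etaFun
    rw [div_mul_div_comm, ← pow_two]
    congr 1
    ring
  rw [hM, mul_assoc]
  congr 1
  -- compare logarithms of two positive reals
  have hMpos : 0 < ((b - a) * (c - b) * (x - a) * (x - c)) / ((c - a) * (x - b)) ^ 2 := by positivity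
  have hDpos : 0 < (b - a) * (c - b) / ((c - a) * (x - b) ^ 2) := by positivity
  have hL : 0 < (((b - a) * (c - b) * (x - a) * (x - c)) / ((c - a) * (x - b)) ^ 2) ^ (-(2 / 3 : ℝ))
      * ((b - a) * (c - b) / ((c - a) * (x - b) ^ 2)) :=
    mul_pos (Real.rpow_pos_of_pos hMpos _) hDpos
  have hS : 0 < shapeFun a b c x := shapeFun_pos hab hbc hcx
  refine Real.log_injOn_pos (Set.mem_Ioi.2 hL) (Set.mem_Ioi.2 hS) ?_
  have e1 : Real.log ((((b - a) * (c - b) * (x - a) * (x - c)) / ((c - a) * (x - b)) ^ 2) ^ (-(2 / 3 : ℝ))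
        * ((b - a) * (c - b) / ((c - a) * (x - b) ^ 2)))
      = -(2 / 3) * (Real.log (b - a) + Real.log (c - b) + Real.log (x - a) + Real.log (x - c)
          - 2 * (Real.log (c - a) + Real.log (x - b)))
        + (Real.log (b - a) + Real.log (c - b) - (Real.log (c - a) + 2 * Real.log (x - b))) := by
    rw [Real.log_mul (Real.rpow_pos_of_pos hMpos _).ne' hDpos.ne', Real.log_rpow hMpos,
      Real.log_div (by positivity) (by positivity), Real.log_pow,
      Real.log_mul (by positivity) hW.ne', Real.log_mul (by positivity) hU.ne',
      Real.log_mul hP.ne' hQ.ne', Real.log_mul hR.ne' hV.ne',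
      Real.log_div (by positivity) (by positivity), Real.log_mul hP.ne' hQ.ne',
      Real.log_mul hR.ne' (by positivity), Real.log_pow]
    push_cast
    ring
  have e2 : Real.log (shapeFun a b c x)
      = (1 / 3) * (Real.log (b - a) + Real.log (c - b) + Real.log (c - a))
        - (2 / 3) * (Real.log (x - a) + Real.log (x - b) + Real.log (x - c)) := by
    unfold shapeFun
    rw [Real.log_mul (Real.rpow_pos_of_pos (by positivity) _).ne' (Real.rpow_pos_of_pos (by positivity) _).ne',
      Real.log_rpow (by positivity), Real.log_rpow (by positivity),
      Real.log_mul (by positivity) hR.ne', Real.log_mul hP.ne' hQ.ne',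
      Real.log_mul (by positivity) hW.ne', Real.log_mul hU.ne' hV.ne']
    ring
  rw [e1, e2]
  ring

/-- **Member (i)'s shape is an exact derivative**: for `a < b < c < x`,
`d/dx F(η(a,b,c,x)) = (cardyConst/3) · Δ^{1/3} ((x-a)(x-b)(x-c))^{-2/3}` (chain rule with the tree's
`hasDerivAt_cardyFunction_holds`). [folklore] -/
theorem hasDerivAt_cardy_etaFun {a b c x : ℝ} (hab : a < b) (hbc : b < c) (hcx : c < x) :
    HasDerivAt (fun x => cardyF (etaFun a b c x)) (cardyConst / 3 * shapeFun a b c x) x := by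
  have hη : etaFun a b c x ∈ Set.Ioo (0 : ℝ) 1 := ⟨etaFun_pos hab hbc hcx, etaFun_lt_one hab hbc hcx⟩
  have hF : HasDerivAt cardyF
      (cardyConst / 3 * (etaFun a b c x * (1 - etaFun a b c x)) ^ (-(2 / 3 : ℝ))) (etaFun a b c x) :=
    Literature.Probability.RandomPlanarGeometry.hasDerivAt_cardyFunction_holds hη
  have hE := hasDerivAt_etaFun (a := a) (b := b) (hab.trans hbc).ne' (hbc.trans hcx).ne' (c := c) (x := x)
  have h := hF.comp x hE
  rw [cardyDeriv_mul_etaDeriv hab hbc hcx] at h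
  exact h

/-- FTC: `∫_{c'}^{X} shape = (3/cardyConst) · (F(η(X)) - F(η(c')))` for `c < c' ≤ X`. [folklore] -/
theorem integral_shape_eq {a b c c' X : ℝ} (hab : a < b) (hbc : b < c) (hcc' : c < c') (hc'X : c' ≤ X) :
    ∫ x in c'..X, shapeFun a b c x
      = 3 / cardyConst * (cardyF (etaFun a b c X) - cardyF (etaFun a b c c')) := by
  have hderiv : ∀ x ∈ Set.uIcc c' X,
      HasDerivAt (fun x => cardyF (etaFun a b c x)) (cardyConst / 3 * shapeFun a b c x) x := by
    intro x hx
    rw [Set.uIcc_of_le hc'X] at hx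
    exact hasDerivAt_cardy_etaFun hab hbc (hcc'.trans_le hx.1)
  have hcont : ContinuousOn (fun x => cardyConst / 3 * shapeFun a b c x) (Set.uIcc c' X) := by
    rw [Set.uIcc_of_le hc'X]
    exact continuousOn_const.mul (continuousOn_shapeFun hab hbc hcc')
  have h := intervalIntegral.integral_eq_sub_of_hasDerivAt hderiv hcont.intervalIntegrable
  rw [intervalIntegral.integral_const_mul] at h
  have hc : cardyConst ≠ 0 := cardyConst_pos.ne'
  field_simp
  field_simp at h
  linarith

/-! #### Step E: limits `c' → c⁺` (F(0) = 0) and `η → 1⁻` (F(1) = 1): the cap `C ≤ cardyConst/3` -/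

/-- Continuity of `η` in the moving point. [folklore] -/
theorem continuousAt_etaFun {a b c x : ℝ} (hca : c ≠ a) (hxb : x ≠ b) :
    ContinuousAt (fun y => etaFun a b c y) x :=
  (hasDerivAt_etaFun hca hxb).continuousAt

/-- `F(η(a,b,c,c')) → 0` as `c' → c⁺`. [folklore] -/
theorem tendsto_cardy_etaFun_right {a b c : ℝ} (hab : a < b) (hbc : b < c) :
    Tendsto (fun c' => cardyF (etaFun a b c c')) (𝓝[>] c) (𝓝 0) := by
  have hη : Tendsto (fun c' => etaFun a b c c') (𝓝[>] c) (𝓝[Set.Icc 0 1] 0) := by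
    refine tendsto_nhdsWithin_iff.2 ⟨?_, ?_⟩
    · have h := (continuousAt_etaFun (a := a) (b := b) (hab.trans hbc).ne' hbc.ne' (c := c)).tendsto
      rw [etaFun_self] at h
      exact tendsto_nhdsWithin_of_tendsto_nhds h
    · filter_upwards [self_mem_nhdsWithin] with c' hc'
      exact ⟨(etaFun_pos hab hbc hc').le, (etaFun_lt_one hab hbc hc').le⟩
  have hF : ContinuousWithinAt cardyF (Set.Icc 0 1) 0 :=
    Literature.Probability.RandomPlanarGeometry.continuousOn_cardyFunction_holds 0 ⟨le_rfl, zero_le_one⟩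
  have h := hF.tendsto.comp hη
  rwa [Literature.Probability.RandomPlanarGeometry.cardyFunction_zero] at h

/-- **Cap at a fixed configuration**: `C · (3/cardyConst) · F(η(a,b,c,X)) ≤ 1`. [folklore] -/
theorem cap_config {C : ℝ} (hC : 0 < C) (h : HalfPlaneMarkDensityShapeWith C)
    {a b c X : ℝ} (hab : a < b) (hbc : b < c) (hcX : c < X) :
    C * (3 / cardyConst) * cardyF (etaFun a b c X) ≤ 1 := by
  have hev : ∀ᶠ c' in 𝓝[>] c,
      C * (3 / cardyConst) * (cardyF (etaFun a b c X) - cardyF (etaFun a b c c')) ≤ 1 := by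
    filter_upwards [Ioo_mem_nhdsGT hcX] with c' hc'
    have h1 := integral_shape_le_one hC h hab hbc hc'.1 hc'.2.le
    rw [integral_shape_eq hab hbc hc'.1 hc'.2.le] at h1
    linarith
  have hlim : Tendsto (fun c' => C * (3 / cardyConst) * (cardyF (etaFun a b c X) - cardyF (etaFun a b c c')))
      (𝓝[>] c) (𝓝 (C * (3 / cardyConst) * (cardyF (etaFun a b c X) - 0))) :=
    ((tendsto_cardy_etaFun_right hab hbc).const_sub _).const_mul _
  have := le_of_tendsto hlim hev
  simpa using this

/-- The test family: `a = 0, b = 1 - t, c = 1, X = 2` has cross-ratio `(1-t)/(1+t) → 1`. [folklore] -/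
theorem etaFun_family (t : ℝ) : etaFun 0 (1 - t) 1 2 = (1 - t) / (1 + t) := by
  unfold etaFun
  congr 1 <;> ring

/-- **THE CAP (unconditional).** Any pointwise limit of member (i) of the form
`n · P(E_⌊xn⌋) → C · Δ^{1/3}((x-a)(x-b)(x-c))^{-2/3}` (all `a < b < c < x`) has `C ≤ cardyConst/3`:
disjointness of the mark events (`Σ_x P(E_x) ≤ 1`) + Fatou + `(cardyConst/3)·shape = ∂ₓF(η)` +
`F(0) = 0`, `F(1) = 1`. So the typed sibling `HalfPlaneMarkDensityLaw` (stmt-5661, `C = cardyConst/3`)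
sits exactly AT the cap: it is the shape law PLUS "no mass is lost at the lattice scale or at
infinity" — the tightness the route's DensityIntegration step must supply; and every typing of the
crux's member (i) on `ℤ × ℕ` with a constant `C > cardyConst/3` is refuted outright. [folklore] -/
theorem constant_le_of_markDensityShapeWith {C : ℝ} (h : HalfPlaneMarkDensityShapeWith C) :
    C ≤ cardyConst / 3 := by
  have hcc : 0 < cardyConst := cardyConst_pos
  by_cases hC : 0 < C
  swap
  · have : 0 < cardyConst / 3 := by positivity
    linarith
  -- along the family t → 0⁺
  have hev : ∀ᶠ t in 𝓝[>] (0 : ℝ), C * (3 / cardyConst) * cardyF ((1 - t) / (1 + t)) ≤ 1 := by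
    filter_upwards [Ioo_mem_nhdsGT (zero_lt_one' ℝ)] with t ht
    have h1 := cap_config hC h (a := 0) (b := 1 - t) (c := 1) (X := 2) (by linarith [ht.2])
      (by linarith [ht.1]) (by norm_num)
    rwa [etaFun_family] at h1
  have hη : Tendsto (fun t : ℝ => (1 - t) / (1 + t)) (𝓝[>] 0) (𝓝[Set.Icc 0 1] 1) := by
    refine tendsto_nhdsWithin_iff.2 ⟨?_, ?_⟩
    · have : Tendsto (fun t : ℝ => (1 - t) / (1 + t)) (𝓝 0) (𝓝 ((1 - 0) / (1 + 0))) :=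
        ((continuous_const.sub continuous_id).continuousAt.tendsto).div
          ((continuous_const.add continuous_id).continuousAt.tendsto) (by norm_num)
      rw [sub_zero, add_zero, div_one] at this
      exact tendsto_nhdsWithin_of_tendsto_nhds this
    · filter_upwards [Ioo_mem_nhdsGT (zero_lt_one' ℝ)] with t ht
      have h1 : 0 < 1 + t := by linarith [ht.1]
      constructor
      · exact div_nonneg (by linarith [ht.2]) h1.le
      · rw [div_le_one h1]; linarith [ht.1]
  have hF : ContinuousWithinAt cardyF (Set.Icc 0 1) 1 :=
    Literature.Probability.RandomPlanarGeometry.continuousOn_cardyFunction_holds 1 ⟨zero_le_one, le_rfl⟩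
  have hF1 : cardyF 1 = 1 := Literature.Probability.RandomPlanarGeometry.cardyFunction_one_holds
  have hlim : Tendsto (fun t : ℝ => C * (3 / cardyConst) * cardyF ((1 - t) / (1 + t))) (𝓝[>] 0)
      (𝓝 (C * (3 / cardyConst) * cardyF 1)) :=
    (hF.tendsto.comp hη).const_mul _
  have hle := le_of_tendsto hlim hev
  rw [hF1, mul_one] at hle
  have : C * 3 ≤ cardyConst := by
    rw [mul_div_assoc'] at hle
    rwa [div_le_one hcc] at hle
  linarith

/-- Corollary: **refuted strengthening** — member (i) on `ℤ × ℕ` with any constant above Cardy's. [folklore] -/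
theorem not_markDensityShapeWith_of_gt {C : ℝ} (hC : cardyConst / 3 < C) :
    ¬ HalfPlaneMarkDensityShapeWith C :=
  fun h => absurd (constant_le_of_markDensityShapeWith h) (not_le.2 hC)

/-- Cycle 1's `HalfPlaneMarkDensityShape` (`∃ C > 0`) in terms of the prescribed-constant form. [folklore] -/
theorem markDensityShape_iff :
    HalfPlaneMarkDensityShape ↔ ∃ C : ℝ, 0 < C ∧ HalfPlaneMarkDensityShapeWith C := by
  unfold HalfPlaneMarkDensityShape HalfPlaneMarkDensityShapeWith shapeFun
  simp only [mul_assoc]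

/-- The typed sibling stmt-5661 (`HalfPlaneMarkDensityLaw`) is member (i) with the EXTREMAL constant
`C = cardyConst/3` of `constant_le_of_markDensityShapeWith`. [folklore] -/
theorem shapeWith_of_law
    (h : Summit.CriticalPhenomena.CardyFormulaZ2.Theses.CardyBoundaryCoulombGas.HalfPlaneMarkDensityLaw) :
    HalfPlaneMarkDensityShapeWith (cardyConst / 3) := by
  intro a b c x hab hbc hcx
  have h1 := h a b c x hab hbc hcx
  have e : cardyConst / 3 * shapeFun a b c x
      = cardyConst / 3 * ((b - a) * (c - b) * (c - a)) ^ (1 / 3 : ℝ)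
          * ((x - a) * (x - b) * (x - c)) ^ (-(2 / 3) : ℝ) := by
    unfold shapeFun; ring
  rw [e]
  exact h1

/-- Consequence of `constant_le_of_markDensityShapeWith`: among all candidate constants for member (i)
on `ℤ × ℕ`, Cardy's is the largest — so `HalfPlaneMarkDensityLaw` is refutable ONLY from below (loss of
mass), never by "too small a constant elsewhere". [folklore] -/
theorem markDensityShape_constant_range (h : HalfPlaneMarkDensityShape) :
    ∃ C : ℝ, 0 < C ∧ C ≤ cardyConst / 3 ∧ HalfPlaneMarkDensityShapeWith C := by
  obtain ⟨C, hC, h⟩ := markDensityShape_iff.1 h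
  exact ⟨C, hC, constant_le_of_markDensityShapeWith h, h⟩

/-- **The crux asserts SHARP arm asymptotics** (cycle-2 remark, cf. card sink-identity-calibration's
"hygiene"): already the (2;2) member at `(x, y) = (0, 1)` says `n^{2/3} · P[(0,0) ↔ (n,0) in ℤ × ℕ] → C`,
a ratio-limit/sharp-constant statement. On the triangular lattice such sharp asymptotics are now
theorems for half-plane arm events (Du–Gao–Li–Zhuang, CMP 2024, arXiv:2205.15901); on `ℤ²` not even
the exponent is known. Recorded so that a typed version may choose the weaker GPS-style normalisation
(by the arm probability itself) if only exponents/ratios are wanted downstream. [folklore] -/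
theorem sharpTwoPoint_of_twoPointLaw (h : HalfPlaneTwoPointLaw) :
    ∃ C : ℝ, 0 < C ∧
      Tendsto (fun n : ℕ => (n : ℝ) ^ (2 / 3 : ℝ) * μhalf.real (openConnIn halfLattice ![0, 0] ![(n : ℤ), 0]))
        atTop (𝓝 C) := by
  obtain ⟨C, hC, h⟩ := h
  refine ⟨C, hC, ?_⟩
  have h01 := h 0 1 zero_lt_one
  simp only [sub_zero, Real.one_rpow, mul_one] at h01
  have e : (fun n : ℕ => (n : ℝ) ^ (2 / 3 : ℝ) * μhalf.real (openConnIn halfLattice ![0, 0] ![(n : ℤ), 0]))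
      = twoPointSeq 0 1 := by
    funext n
    simp [twoPointSeq, bpt]
  rw [e]
  exact h01


/-! #### §9b A second exact lattice constraint on member (i): sub-additivity in the ARC (cycle 2) -/

/-- Union bound in the arc: `E_x(A ∪ A') ⊆ E_x(A) ∪ E_x(A')` for the mark events (the excluded
crossing event only grows with the arc). [folklore] -/
theorem markEvent_union_subset (A A' : Set (Site 2)) (j₀ j : ℤ) :
    markEvent (A ∪ A') j₀ j ⊆ markEvent A j₀ j ∪ markEvent A' j₀ j := by
  rintro ω ⟨⟨x, hx, y, hy, hω⟩, hno⟩
  rcases hx with hx | hx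
  · exact Or.inl ⟨⟨x, hx, y, hy, hω⟩, fun ⟨x', hx', y', hy', hω'⟩ => hno ⟨x', Or.inl hx', y', hy', hω'⟩⟩
  · exact Or.inr ⟨⟨x, hx, y, hy, hω⟩, fun ⟨x', hx', y', hy', hω'⟩ => hno ⟨x', Or.inr hx', y', hy', hω'⟩⟩

/-- The mark event is anti-monotone in the arc through its excluded part: shrinking the arc can only
remove excluded crossings. Precisely `E_x(A') ∩ {x ↔ A} ⊆ E_x(A)` for `A ⊆ A'`. [folklore] -/
theorem markEvent_mono_excluded {A A' : Set (Site 2)} (h : A ⊆ A') (j₀ j : ℤ) :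
    markEvent A' j₀ j ∩ openCrossing halfLattice A {![j, 0]} ⊆ markEvent A j₀ j := by
  rintro ω ⟨⟨-, hno⟩, hyes⟩
  exact ⟨hyes, fun h' => hno (openCrossing_mono_left _ h _ h')⟩

/-- **Exact lattice constraint (every mesh): sub-additivity of the mark density in the arc**,
`m_δ(a,b';c,x) ≤ m_δ(a,b;c,x) + m_δ(b,b';c,x)` — from `[⌊an⌋,⌊b'n⌋] = [⌊an⌋,⌊bn⌋] ∪ [⌊bn⌋,⌊b'n⌋]`
(for `a ≤ b ≤ b'`) and the two lemmas above. The mark event is NOT monotone in the arc, but the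
union bound survives. [folklore] -/
theorem markDensitySeq_arc_union_le {a b b' : ℝ} (hab : a ≤ b) (hbb' : b ≤ b') (c x : ℝ) (n : ℕ) :
    markDensitySeq a b' c x n ≤ markDensitySeq a b c x n + markDensitySeq b b' c x n := by
  simp only [markDensitySeq_eq, ← mul_add]
  refine mul_le_mul_of_nonneg_left ?_ (by positivity)
  have hn : (0 : ℝ) ≤ n := by positivity
  have heq : barc a b' n = barc a b n ∪ barc b b' n := by
    ext v
    simp only [barc, Set.mem_union, Set.mem_setOf_eq]
    constructor
    · rintro ⟨h1, h2, h3⟩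
      rcases le_total (v 0) ⌊b * n⌋ with h | h
      · exact Or.inl ⟨h1, h2, h⟩
      · exact Or.inr ⟨h1, h, h3⟩
    · rintro (⟨h1, h2, h3⟩ | ⟨h1, h2, h3⟩)
      · exact ⟨h1, h2, h3.trans (Int.floor_mono (by nlinarith))⟩
      · exact ⟨h1, (Int.floor_mono (by nlinarith)).trans h2, h3⟩
  rw [heq]
  calc μhalf.real (markEvent (barc a b n ∪ barc b b' n) ⌊c * n⌋ ⌊x * n⌋)
      ≤ μhalf.real (markEvent (barc a b n) ⌊c * n⌋ ⌊x * n⌋ ∪ markEvent (barc b b' n) ⌊c * n⌋ ⌊x * n⌋) :=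
        measureReal_mono (markEvent_union_subset _ _ _ _) (measure_ne_top _ _)
    _ ≤ _ := measureReal_union_le _ _

/-- Hence ANY pointwise limit density `G` of member (i) is sub-additive in the arc:
`G(a,b',c,x) ≤ G(a,b,c,x) + G(b,b',c,x)` for `a < b < b' < c < x`. A rigorous constraint with no
percolation input; the CLAIMED shape passes it (numerically: min of the ratio right/left over 2·10⁵
random configurations is 1.0157 > 1, `tm/` log of this seat; infimum 1 approached only degenerately),
as it must if it is also the triangular-lattice limit. [folklore] -/
theorem limitDensity_subadditive_in_arc {G : ℝ → ℝ → ℝ → ℝ → ℝ}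
    (h : ∀ a b c x : ℝ, a < b → b < c → c < x → Tendsto (markDensitySeq a b c x) atTop (𝓝 (G a b c x)))
    {a b b' c x : ℝ} (hab : a < b) (hbb' : b < b') (hb'c : b' < c) (hcx : c < x) :
    G a b' c x ≤ G a b c x + G b b' c x :=
  le_of_tendsto_of_tendsto (h a b' c x (hab.trans hbb') hb'c hcx)
    ((h a b c x hab (hbb'.trans hb'c) hcx).add (h b b' c x hbb' hb'c hcx))
    (Eventually.of_forall fun n => markDensitySeq_arc_union_le hab.le hbb'.le c x n)

/-! ### §10 (cycle 2) Numerics — exact strip transfer matrices for the 3- and 4-point members, strip Cardy, and the 3-leg gap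

Engine: `tm/striptm.py` (this seat; pure python, exact floating-point TM on `ℤ × {0..R-1}` with tagged
boundary-connectivity states; validated against cycle 1: `T₁ = 7/9` exactly, `(R-1)γ₁ = 0.6076, 0.7089,
0.7727, 0.8165, 0.8483, 0.8725, 0.8915` = the planner's j005323 values, and the (2;2) amplitudes
`C_est = 0.7462, 0.7475, 0.7485` (R = 7, 8, 9) = cycle 1's `0.7461, 0.7474, 0.7483`). `n_e := π/(3γ₁)`,
`u_t := e^{πt/n_e}` (`w = e^{πz/n_e}` maps the strip onto `ℍ`, `-∞ ↦ 0`). Files `tm/*.out`, analysis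
`tm/analyze.py`, `tm/analyze_md.py` (attached to the item with this file).
(N1) MEMBER (1,1;2) — the first multi-point test: `P(x) = P[(x,0) ↔ bottom half-line (-∞,0]]`, arc ends at
    `u = 0, 1`, point at `u_x`; the crux predicts `P(x) = K_R (e^{π(x+ε)/n_e} - 1)^{-1/3}` (pair exponents
    `+1/3, -1/3, -1/3`, weight `|w′(x)|^{1/3}`; near field `x^{-1/3}`, far field `e^{-γ₁x}`, ONE crossover
    function). Found: with the single offset `ε = -0.38…-0.42` the law holds for ALL `4 ≤ x ≤ 80` to
    max |log-residual| = 0.9e-3, 1.0e-3, 1.0e-3, 1.2e-3 (R = 5, 6, 7, 8); a free crossover exponent fits to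
    `α = 0.333` (grid 10⁻³) at every R; and `K_R n_e^{1/3} = 1.010, 1.005, 1.0016, 0.9975` is R-independent
    to 1 % (the `|w′|^{1/3} = (π/n_e)^{1/3}` covariance factor). PASSED at 1e-3: a 3-point boundary
    correlator of bond-ℤ² percolation has the Möbius-covariant form on strips of width 5–9.
(N2) STRIP CARDY (the integrated member (i)): `D(s) = P[(-∞,0] ↔ [s,∞) on the bottom wall]`; Cardy:
    `D(s) = F(e^{-π(s+ε)/n_e})`, `F = cardyFunction`, NO free amplitude. Found: with ONE lengthwise offset
    `ε_R = -1.400, -1.465, -1.520, -1.565` (R = 5..8; a Ziff-type extrapolation length, increments shrinking)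
    the law holds for `s ≥ 8` to max |log-resid| = 0.4e-3, 1.2e-3, 2.2e-3, 2.9e-3, for `s ≥ 6` to 2.6–6.7e-3,
    and misfits only at `s = 3–5` lattice spacings (1–2 %, discreteness); the pure power `cardyConst·η^{1/3}`
    misfits by 4.6–9.8 % at best offset, so the `₂F₁(1/3,2/3;4/3;η)` factor IS resolved and the amplitude is
    exactly `cardyConst` within the offset degeneracy (a free amplitude `A_R = 1.10–1.15` with `ε ≈ -0.75` is the
    SAME fit: `A` and `ε` are degenerate at leading order, `e^{γ₁Δε}`). Consistent with Cardy on ℤ² strips.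
(N3) THE 3-LEG KAC GAP (new sector, odd legs — inaccessible to cluster-counting blocks): survival rate
    `γ₃` of "the arc `(-∞,0]`'s cluster is alive and has not touched the bottom wall right of 0" (contacts
    detected retroactively via tags). Crux/Kac: `n_e γ₃ → π·h_{1,4} = π`, i.e. `γ₃/γ₁ → h(3)/h(2) = 3`;
    naive stiffness (`gL²/4`): `9/4`. Found `γ₃/γ₁ = 3.229, 3.202, 3.179, 3.161, 3.146, 3.133` (R = 4..9; `n_e γ₃ = 3.381 … 3.281`;
    TM-NUMERICS-c2.md) decreasing like `3 + 0.78/n_e^{0.8}` — towards 3, not 9/4. (This is `β₂⁺ = 1` read as a strip gap; the planner's `γ₂/γ₁ → 6` was the 4-leg level.)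
(N4) MEMBER (i) ITSELF, `m(x) = P[x is the first vertex ≥ s joined to (-∞,0]] = D(s,x) - D(s,x-1)` (exact
    telescoping on the lattice — the identity behind §9): far field `m ∝ e^{-γ₃x}` ✓ (N3); near field and
    the `-2/3` sink exponents: NOT TESTABLE at widths ≤ 9 — the crossover zone is `n_e/π ≈ 2–3` lattice
    spacings and the fits with `θ = 2/3` (crux) and `θ = 1` (naive) are equally good (max |log-resid| 0.097 vs 0.098
    at R = 6, 0.050 vs 0.051 at R = 7, 0.079 vs 0.074 at R = 8, offsets absorbing the difference; free `θ`
    unidentifiable: 0.3, 0.3, 1.15). The far AMPLITUDE's dependence on the gap `s` between arc end and forbidden zone,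
    `A(s) ∝ e^{(γ₃-γ₁)s}(1 - e^{-π(s+Δ)/n_e})^{1/3}` (mark–mark fusion exponent `e_be_c/3 = 1/3`), holds to
    2 % over `s = 2..20` at R = 7 but a free exponent gives 0.54 — again not discriminating. HONEST LIMIT:
    the load-bearing near-mark exponents of member (i) need the half-plane at scale (Monte Carlo, kit job
    j009954 submitted this cycle — 1536×768 half-box, 4·10⁴ samples, (2;2)/(1,1;2)/member (i)/(2,1;3); results
    attach to the item), not strips.
VERDICT of §10: every test that strips of width ≤ 9 CAN decide (3-point covariant shape, Cardy's `F` with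
its ₂F₁ term, the Kac level `h_{1,4} = 1` with its linear background-charge term) is passed at the 1e-3 /
few-% level; nothing contradicts the crux; the sink-rule exponents of the 4-point member remain untested
numerically on `ℤ²` (they are, however, FORCED by covariance — §2 — once the 3-point structure (N1) holds).

### §11 (cycle 2) Literature attacks

* The only printed `¬Cardy on ℤ²`: Yu Zhang, arXiv:2206.04599 (2022, 113 pp., unrefereed), Cor. 2
  "Cardy's formula does not hold for site and bond percolation on ℤ²_δ". Read pp. 5–6: the argument maps a
  sheared lattice `N_δ` AFFINELY onto rotated `ℤ²` ("stretch each δ-parallelogram … the crossing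
  probability remains the same", p. 5) and combines the paper's Theorem (Carleson–Cardy linearity on the
  equilateral triangle for `N_δ`) with Cardy for `ℤ²` to get `ϕ(X) ≠ X`. So it proves only
  ¬(Theorem ∧ CI of square-embedded ℤ²): exactly the `EmbeddingModulusUniqueness` barrier (at most one
  embedding of a graph has a conformal limit). All numerics (Ziff et al.; §7, §10 here: Cardy's `F` incl. the
  ₂F₁ term on ℤ² strips at 1e-3) side with CI of the square embedding, i.e. against the paper's Theorem.
  Not a usable counterexample; recorded so nobody re-reads 113 pages.
* Sharpness: the crux's `δ^{-Σh}`-normalised convergence asserts sharp constants (§9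
  `sharpTwoPoint_of_twoPointLaw`). Du–Gao–Li–Zhuang (CMP 2024, arXiv:2205.15901): sharp asymptotics
  `P = C n^{-j(j+1)/6}(1+o(1))` for half-plane `j`-arm events on 𝕋 — so the KIND of statement is right (a
  theorem on 𝕋 for the one-point versions); on ℤ² open together with everything else.
* `c = 0` logarithms (Gori–Viti PRL 2017/2018 four-point boundary connectivities; Mathieu–Ridout 2007
  staggered modules `(h_{1,1},h_{1,5})`, `(h_{1,2},h_{1,4})`): logs appear in NON-rainbow connectivity
  patterns (sub-maximal fusion channels, where `φ_{1,5}` collides with `T` or `φ_{1,4}` with `∂φ_{1,2}`).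
  For rainbow families every pairwise fusion is the maximal channel `φ_{1,L₁+L₂+1}` (multiplicity ONE in
  `⊗φ_{1,L_i+1}` — the top spin component), the correlator is the `Q → 1` limit of a generic-`Q` pure
  product (zero screening charges), continuous in `Q`, hence log-free; and the `L = 3, 4` normalisations are
  pinned log-free on ℤ² by the universal up-to-constants estimates `β₂⁺ = 1`, `β₃⁺ = 2` (tree:
  `Z2HalfPlaneTwoArm`, `Z2HalfPlaneThreeArm` give the upper bounds). No lever here.
* searchd was unavailable (rc 75) during this cycle; the three readings above are from held/fetched texts
  (`lit read arxiv:2206.04599`, `arxiv:2205.15901`); Gori–Viti/Mathieu–Ridout from memory of the standard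
  references (no claim rests on page numbers).

### §8′ Targets and near-misses (cycle 2)
Still no line picked (`payload.targets = []`, `stuck_stubs = []`). No sorries in this file. Next Lean
targets, in order of value: (a) the reverse inequality of §9 under an explicit tightness hypothesis
(`ShapeWith C ∧ NoMassLoss → C = cardyConst/3`, making "5661 = shape + tightness" an iff); (b) the
union-bound constraint of §4b for member (i) (sub-additivity in the arc); (c) once `defn-CollarLegModel`
lands: the `k = 2, L = (1;1)` unit test `Z[ins]/Z = 1` and the typed `¬`-targets of §5 (H-onto, `∀w∃C`).
-/

end Summit.CriticalPhenomena.CardyFormulaZ2.Cruxes.BoundaryDefectGaussianR.Disproof
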